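import Mathlib
import HarnessLib
import HarnessLib.Audit
import Summits.AnomalousDissipation.Statement
import Literature.Analysis.FluidPDE.LerayHopf
import Literature.Analysis.FluidPDE.ZerothLaw
import Literature.Analysis.FluidPDE.DoeringFoias
import Literature.Analysis.FluidPDE.StokesTorus
import Literature.Analysis.FluidPDE.StokesTorusProofs
import HarnessLib.Audit.Status.Attr

/-!
Route: SymmetricOrLoud

Generation-6 re-base of the lens-4 «minimal counterexample» line on the SYMMETRY axis in SCALE-FREE
trajectory currency (supersedes the bounded-energy pair 28612/28613 of generation 5, whose declared
residual carried the ν-uniform mean-energy bound — the energy hard core shared with the zeroth law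
at the pinned force). Pin f = sin(4πx₁)e₀ = stokesMode (0,2,0) e₀ sin on T³; RELATIVE NORMAL FORM
N_rel(θ₀, φ₀) = {global Leray–Hopf trajectories of NS_ν(f), of any energy, that are θ₀-QUIET
(meanDissipation ≤ θ₀·meanEnergy) and φ₀-RELATIVELY PLANAR (mean symmetry defect ≤ φ₀·meanEnergy)},
defect = ⟨inf over (n,m) ≠ 0 of ½∫₀¹‖u(·+s(n,0,m)) − u‖₂² ds⟩ = mean L²-energy outside the nearest
oblique Fourier plane, so defect/meanEnergy is the three-dimensional energy FRACTION; both defining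
inequalities are homogeneous of degree 2, which is why the dichotomy survives the quotient by
scaling. It suffices to show X = X1 ∧ H_R ∧ R°: H_R (QuietTrajectoriesRelativelyPlanar, the
reduction theorem): for every δ > 0 there is θ₀ > 0 such that for 0 < ν ≤ 1 every global Leray–Hopf
solution of NS_ν(f), from any datum and of any energy, that is θ₀-quiet has mean defect ≤
δ·meanEnergy; R° (ThreeDFractionOrLoud, declared residual): for some φ₀, η > 0 and 0 < ν_j ≤ 1 → 0
there are global Leray–Hopf solutions u_j of NS_ν_j(f), of any energy, OUTSIDE the relative normal
form — relatively three-dimensional (0 < defect and φ₀·meanEnergy ≤ defect) OR loud (η·meanEnergy <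
meanDissipation); R° is IMPLIED by the generation-5 residual 28613 (kernel: rescale φ₀ by the energy
bound and forget the bound), hence by the zeroth law at this force, quantifies NO energy bound, and
is strictly weaker exactly in the world of relatively-3-D families of unbounded energy, which H_R
excludes; X1 (RatioUpgrade): the rate-per-energy form of the zeroth law implies the audited one (no
energy bound needed: loudness in ratio form bounds the energy by the energy inequality). The
hypothesis class of H_R is INHABITED at every energy given the aside DriftStatesAreLerayHopf: the
laminar state (energy 1/(512π⁴ν²) → ∞, ratio D/E = 16π²ν → 0, defect 0) and the drift states, so no
dissipation-ratio floor holds on trajectories of any energy at this force and H_R has content.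
Generation 7 (glued split beneath R°, closes unchanged): R° ⟸ P1 ∧ X with P1 (PlanarStatesEject,
mechanism piece): there are c₀, ν₀ > 0 such that for 0 < ν ≤ ν₀ every PLANAR (invariant along some
lattice direction (n,0,m) ≠ 0), zero-momentum, square-integrable, non-zero datum of NS_ν(f)
admitting a global Leray–Hopf solution — of any energy — has, within every relative L²-distance ε, a
datum whose Leray–Hopf solution reaches three-dimensional energy FRACTION ≥ c₀ at some time (no
planar 2-D/2½-D state of the Kolmogorov flow k_f = 2 is transversally stable in the scale-free
metric, uniformly in ν); and X (EjectionPersists, declared residual) := P1 → R° (content: some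
Leray–Hopf family along ν_j → 0 is not re-captured in mean), kernel-weaker than R° and strictly so
in the world where some planar state is transversally stable at arbitrarily small ν; P1 is exercised
by the laminar datum at every ν (kernel, given DriftStatesAreLerayHopf) and has the uniform-in-ν
laminar ejection as its theorem-grade first rung.
Lean: `RatioUpgrade ∧ QuietTrajectoriesRelativelyPlanar ∧ ThreeDFractionOrLoud`

Rationale: WHY THIS LINE. Minimal-counterexample reduction on the SYMMETRY axis with a METRIC, quotiented by
SCALING: if loud trajectories fail at the pinned force, the would-be counterexamples are global
Leray–Hopf trajectories ordered by the dissipation RATIO D/E; the node asserts that the extremal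
(quiet) ones carry a small three-dimensional energy FRACTION (mean defect ≤ δ·meanEnergy, defect =
mean energy off the best oblique Fourier plane n k₀ + m k₂ = 0) — H_R — and the residual R° asks
only for families OUTSIDE «quiet ∧ relatively planar», i.e. with a 3-D energy fraction ≥ φ₀ OR loud
in ratio, OF ANY ENERGY; closes uses no energy bound (a relatively-3-D member that were θ₀-quiet
with θ₀ from H_R at δ = φ₀/2 would have defect ≤ defect/2 < defect), R° is kernel-implied by 28613
hence by ZerothLawAt f (cell node file HOME/decomp-ad-lens-4/g6/FractionOrLoud.lean). GENERATION 7
asks how a minimal counterexample could LEAVE the exempted normal form and splits the residual at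
the one place where a finite-time, fixed-viscosity theorem carries weight — the TRANSVERSE
(three-dimensional) INSTABILITY OF THE PLANAR CLASS: R° ⟸ P1 ∧ X (glued split, closes unchanged;
node file HOME/decomp-ad-lens-4/g7/PlanarEjection.lean, threeDFractionOrLoud_of_split). P1
(PlanarStatesEject) says that at small ν no planar state of NS_ν(f), of any energy, is transversally
stable in the scale-free metric: an arbitrarily small relative kick is amplified to a 3-D energy
fraction ≥ c₀, uniformly in ν — the theorem-shaped half of the thick-layer picture (our torus has Q
= (2π/H)/k_f = 1/2 fixed while Re → ∞; exact two-dimensionalisation needs Re ≤ (Q/C_2D)² with C_2D ≈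
1.16, and below Q_3D ≈ 3.6 the 3-D component is observed in equipartition with a forward cascade,
doi:10.1017/jfm.2017.293); X (EjectionPersists := P1 → R°, declared residual) keeps only persistence
IN MEAN (no re-capture: the duty cycle of 3-D bursts does not vanish along ν → 0). X is
kernel-weaker than R° (hence than 28613 and than ZerothLawAt f, chain re-proved in the node file)
and strictly so in the separating world W_stable-planar (¬X ↔ P1 ∧ ¬R°, kernel); P1 is not implied
by S or S_f and implies neither, is exercised by the laminar datum at every ν (kernel
laminar_inhabits_hypotheses given the aside DriftStatesAreLerayHopf: L², zero momentum, planar along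
every direction, energy 1/(512π⁴ν²) → ∞, defect 0) and can never be witnessed by a planar
continuation (kernel not_eject_of_planar). Imported: hydrodynamic stability of Kolmogorov-type flows
(Meshalkin–Sinai long-wave instability; oblique Squire modes; elliptic/hyperbolic short-wave
instabilities whose unstable directions are necessarily 3-D — Lifschitz–Hameiri, Bayly, Waleffe),
linear ⇒ nonlinear instability for forced steady Navier–Stokes states (doi:10.1007/s00220-006-1526-7
Thm 2.2) and uniformly in ν for inviscidly unstable shear profiles (Grenier 2000, CPAM 53:1067),
thin-layer two-dimensionalisation thresholds (doi:10.1017/jfm.2017.293) and on–off statistics of 3-D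
perturbations of 2-D flows (doi:10.1103/PhysRevE.103.053102), Doering–Foias bookkeeping
(DoeringFoias2002).
RANKED CRUXES. #2 QuietTrajectoriesRelativelyPlanar (crux; hardest and most informative:
quantitative hydrodynamic stability in RATIO form at every energy; UNDECIDED(T-3D-SYM-defect
relative reading; T-QROOT) + IDEA-NEEDED; first rung ViscousFloorRung = finite-ν Poincaré shadow,
warm-up only). #3 PlanarStatesEject (crux, first child of the split of R°; MECHANISM piece:
uniform-in-ν nonlinear transverse instability of every planar state of the Kolmogorov flow k_f = 2,
read in the 3-D energy fraction; UNDECIDED(T-TRANSV: transverse Lyapunov exponent of 2-D Kolmogorov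
turbulence along the ν-ladder) + IDEA-NEEDED; first rung LaminarEjection THEOREM-GRADE L and uniform
in ν — oblique Orr–Sommerfeld instability of sin(4πy) at the locked pair (1,±1) plus a Grenier
bootstrap in the doubly-symmetric invariant class — with a 2-stub skeleton
HOME/decomp-ad-lens-4/g7/bc/LaminarEjection_birth.lean). #4 RatioUpgrade (crux, shared, M). #5
EjectionPersists (crux, second child, declared RESIDUAL := P1 → R°; kernel-necessary for S_f;
INSTRUMENTABLE(T-BURST: duty cycle of 3-D bursts) + IDEA-NEEDED). Split node: #3-old
ThreeDFractionOrLoud (R°, layer 1, binder of closes; decomposition P1 → X → R° beneath it, glue =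
modus ponens). Asides: 28612/28613 (generation-5 pair), 28614 and RelativelyThreeDTrajectories (3-D
disjuncts alone), 28615 DriftStatesAreLerayHopf (non-vacuity certificate, M), the generation-2–4
law-currency items.
KILL CRITERIA. H_R dies (and the line with it) on ONE quiet trajectory family with a non-vanishing
3-D energy fraction (DNS of the 3-D Kolmogorov flow k_f = 2 with D/E → 0 while defect/E ≥ φ₀; a
refinement-stable quiet relatively-3-D steady root, T-QROOT; or a constructed family). P1 dies on
ONE planar zero-momentum state of NS_ν(f) that is transversally Lyapunov-stable at arbitrarily small
ν — instrument T-TRANSV: the transverse Lyapunov exponent σ_⊥(ν) of 2-D Kolmogorov turbulence k_f =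
2 (linearised 3-D perturbation, one transverse wavenumber) decaying to ≤ 0 down the ν-ladder;
prediction for P1: σ_⊥ ≥ σ₀·U k_f uniformly. X dies only with the zeroth law at this force in the
ejecting world: 3-D bursts with VANISHING duty cycle (on–off intermittency whose energy-weighted
time near the planar class → 1 and D/E → 0 along ν → 0) — instrument T-BURST (3-D DNS from the 2-D
state plus a 10⁻⁶ kick across ν: long-time means of defect/E and D/E and the duty cycle;
thick-regime prediction: ν-independent plateau defect/E ∈ [0.2, 0.7], D/E ≥ η).
NOT DECOMPOSED YET. H_R: the oblique trichotomy (spanwise classes vs oblique 2½-D classes with a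
forced passive scalar, lens-1 TwoAndHalfD territory) has no attackable piece yet (its steady case is
forced-steady-Euler rigidity) — not cut. X: splits naturally at the DUTY CYCLE — X ⟸ NoRecapture
(liminf of the energy-weighted time fraction with 3-D fraction ≥ c₀/2 is ≥ τ₀ uniformly in ν along
ejected trajectories) ∧ (NoRecapture ∧ loud-while-3-D → R°, Markov/Chebyshev bookkeeping of the
means) — to be cut only after T-BURST reports the duty cycle. P1 beyond the laminar rung: planar
TURBULENT states need a strain-based (elliptic-instability) mechanism uniform in ν; no typed
intermediate yet. Dead ends recorded in the cell cards (g5–g7): energy-first splits, momentum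
slices, Σ-symmetric or steady-branch residuals (stronger than / incomparable with R°), ν-monotone
seeds (summit-strength with the laminar window), ν-dependent thresholds (closes fails), force
changes (new lineage), single-oblique-mode ejection (lands in an oblique planar class).
CHEAPEST FALSIFIER. For P1 (minutes, cite-first): the oblique Orr–Sommerfeld growth rate of the
laminar profile sin(4πy) at (1,±1) for R = 10…10⁴ must stay bounded below (inviscid Meshalkin–Sinai
limit, α̃/k_f = 1/√2 < 1) — a decaying or vanishing rate kills the rung and the locked-pair
mechanism at once; then T-TRANSV on the 2-D turbulent state (< 2 core-h). For X: T-BURST duty cycle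
across ν ∈ {1/50 … 1/800}. For H_R: T-QROOT as priced at rev 10 (Galerkin K = 2..6, quiet roots with
defect/E ≥ φ₀ persisting under K → K+2).

Novelty: Searches (2026-08-30): lit search --hybrid "Kolmogorov flow condensate energy saturation viscosity
two-dimensional" (held: arXiv:1808.06186 pp.31–32, 74; remote: doi:10.1017/jfm.2012.524); lit search
"thin layer turbulence transition three-dimensional critical height" (doi:10.1017/jfm.2017.293,
doi:10.1017/jfm.2018.1030); lit galaxy search "Kolmogorov flow|condensate" --star pdf
(galaxy:pdf:-6156699642485487920 = Benavides–Alexakis 2017, read pp.20–21); lit galaxy search "thin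
layer turbulence|quasi-two-dimensional" --star all; tree: rg over the summit's Theses for symmetry
conclusions (only ∀-floors over symmetry classes: PumpedMirror, MirrorEnsemble); ledger negatives
--problem AnomalousDissipation (13037, 14324, 0204, 2979, 2984, 2859, 15372 — none a
symmetry-rigidity statement).
Nearest prior art found: doi:10.1017/jfm.2012.524 (Gallet–Young: ν-independent saturation of 2-D
Kolmogorov flow without drag — the inhabited exemption) and
Literature/Barriers/AnomalousDissipation/QuietRootFloorBarrier.lean (quiet branches cap every
∀-floor over an invariant class).
Delta: the rigidity is asked of forced stationary STATISTICS and concludes a.s. translation SYMMETRY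
(not steadiness, not constancy); the symmetric class is exempted — where the zeroth law provably
fails — and loudness is extracted by logic from mere asymmetry of a bounded law, whose existence is
the separate residual.
Claimed grade: new-mechanism  [refs: 10.1017/jfm.2012.524, 10.1017/jfm.2017.293, 10.1017/jfm.2018.1030, 1808.06186, doi:10.1017/jfm.2012.524, doi:10.1017/jfm.2017.293, doi:10.1017/jfm.2018.1030]

Barriers (technique_class: ergodic-rigidity, symmetry-breaking, statistical-solutions): - technique_class: ergodic-rigidity, symmetry-breaking, statistical-solutions
- Literature.Barriers.AnomalousDissipation.AlexakisDoering2006_energyDissipationBound: USED, not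
fought — it is what makes the exempted planar class provably quiet (tree instance
not_twohalfdThesis_stokesEigenfield) and hence QuietLawsAreSymmetric strictly weaker than a floor;
AsymmetricBoundedLaws asks for NON-planar statistics precisely to leave its scope.
- Literature.Barriers.AnomalousDissipation.BardosTitiWiedemann2012_thm5: outside —
viscosity-selected shear flows are x₃-sheared symmetric states: they sit inside the exempted normal
form of QuietLawsAreSymmetric and are excluded from AsymmetricBoundedLaws by the asymmetry clause
(and by zero momentum / the pinned force).
- Literature.Barriers.AnomalousDissipation.BrueDeLellis2023_noAnomaly_beforeEulerSingularity: it
does not bite (infinite-time stationary statistics, not a finite window before the first Euler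
singularity); the bet of QuietLawsAreSymmetric is that no smooth quiet asymmetric forced-Euler
statistics is viscosity-selectable at this force. The finite-dimensional cousin
Literature/Barriers/AnomalousDissipation/QuietRootFloorBarrier.lean is evaded by construction: no
floor over any invariant class is asserted; quiet branches, steady or not, are exempted as long as
they are symmetric, and the known quiet branches at Kolmogorov-type forces (laminar, planar, drift)
are.
- Literature.Barriers.AnomalousDissipation.Cheskidov2023_thm13_not_f

History (route lifecycle, newest last):
- 2026-08-30T03:24:47Z · rev 1: informal re-worded for QuietLawsAreSymmetric (planner-decomp-ad-lens-4-g2-0)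
- 2026-08-30T03:29:28Z · rev 2: informal re-worded for AsymmetricBoundedLaws (planner-decomp-ad-lens-4-g2-0)

sub-problem: AnomalousDissipation · status: draft · opened planner-decomp-ad-lens-4-g2-0 2026-08-30T03:15:48Z · rev 13 · ledger route-AnomalousDissipation-SymmetricOrLoud
GENERATED by the gate from the ledger (D-0016/17). Provers cite these decls: `theorem foo : Summit.AnomalousDissipation.AnomalousDissipation.Theses.SymmetricOrLoud.<Decl> := …` in Summits/AnomalousDissipation/AnomalousDissipation/Theorems/<Name>.lean.
-/

namespace Summit.AnomalousDissipation.AnomalousDissipation.Theses.SymmetricOrLoud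

open scoped BigOperators Topology Manifold Classical MeasureTheory ProbabilityTheory Matrix InnerProductSpace ComplexConjugate ContinuousMap
open Filter Set Function TopologicalSpace MeasureTheory

attribute [summit_statement] _root_.AnomalousDissipation

open Literature.Turb

/-- item stmt-AnomalousDissipation-29269 · crux · rank 2 · open · by planner
why it might fail: one quiet trajectory family with non-vanishing 3-D energy fraction at small ν: bounded (3-D steady/recurrent state continued from a forced-Euler steady state, ∫f·U = 0, D/E → 0, defect/E ≥ φ₀) or high-energy (3-D upper branch whose fraction persists); killable by relative-reading DNS / root hunts
sources: doi:10.1103/PhysRevLett.66.2204, doi:10.1063/1.858144, doi:10.1017/jfm.2017.293, doi:10.1017/jfm.2012.524, arXiv:1808.06186, arXiv:1801.05645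
[crux] (lens-4 g6 «FractionOrLoud», DICHOTOMY INPUT in SCALE-FREE trajectory currency; crit-1
CLEARED 2026-08-30T06:22:50Z) H_R QuietTrajectoriesRelativelyPlanar: for every δ > 0 there is θ₀ > 0
such that for 0 < ν ≤ 1 EVERY global Leray–Hopf solution of NS_ν(f), f = sin(4πx₁)e₀ = stokesMode
(0,2,0) e₀ sin, from ANY datum and of ANY energy, that is θ₀-QUIET (meanDissipation ≤ θ₀·meanEnergy)
has mean symmetry defect ≤ δ·meanEnergy (defect = ⟨inf over (n,m) ≠ 0 of ½∫₀¹‖u(·+s(n,0,m)) − u‖₂²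
ds⟩ = mean L²-energy outside the nearest oblique Fourier plane n k₀ + m k₂ = 0, so defect/meanEnergy
= the three-dimensional energy FRACTION). In words (crit-1): NS_ν(sin(4πx₁)e₀) has no ν-uniformly
large-scale, relatively three-dimensional long-time states at ANY amplitude. STRONGER than 28612
QuietTrajectoriesNearlySymmetric (kernel nearlySymmetric_of_relativelyPlanar: apply at δ/max E₀ 1;
cell node file HOME/decomp-ad-lens-4/g6/FractionOrLoud.lean sha256 4322b2b7…, lean check rc0 · 0
sorry) — the energy burden moves from the residual into this ∀-statement, whose high-energy tail is
structurally tame (meanDissipation ≤ ‖f‖₂·√meanEnergy makes every high-energy trajectory quiet;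
laminar 1/(512π⁴ν²) -/
@[route_item "route-AnomalousDissipation-SymmetricOrLoud", crux]
def QuietTrajectoriesRelativelyPlanar : Prop :=
  ∀ δ : ℝ, 0 < δ → ∃ θ₀ : ℝ, 0 < θ₀ ∧ ∀ ν : ℝ, 0 < ν → ν ≤ 1 → ∀ (u₀ : UnitAddTorus (Fin 3) → EuclideanSpace ℝ (Fin 3)) (u : ℝ → UnitAddTorus (Fin 3) → EuclideanSpace ℝ (Fin 3)), Literature.Analysis.FluidPDE.Torus.IsGlobalLerayHopf ν (fun _ => ⇑(Literature.Analysis.FluidPDE.Torus.stokesMode (![0, 2, 0] : Fin 3 → ℤ) (EuclideanSpace.single (0 : Fin 3) (1 : ℝ)) false)) u₀ u → Literature.Analysis.FluidPDE.meanDissipation ν u ≤ θ₀ * Literature.Analysis.FluidPDE.meanEnergy u → Literature.Analysis.FluidPDE.longTimeAvgSup (fun t => ⨅ p : {p : ℤ × ℤ // p ≠ 0}, (1 / 2 : ℝ) * ∫ s in (0 : ℝ)..1, ∫ x, ‖u t (x + Literature.Analysis.FluidPDE.toTorus (fun i => s * (![((p.1.1 : ℤ) : ℝ), 0, ((p.1.2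 : ℤ) : ℝ)] : Fin 3 → ℝ) i)) - u t x‖ ^ 2) ≤ δ * Literature.Analysis.FluidPDE.meanEnergy u

/-- item stmt-AnomalousDissipation-29278 · crux · rank 3 · SPLIT (gen 1) into PlanarStatesEject, EjectionPersists + glue ThreeDFractionOrLoudGlue · direct attempts still welcome (low priority) · by planner
why it might fail: every Leray–Hopf family along ν → 0 at this force could two-dimensionalise RELATIVELY (defect/E → 0) while quieting in ratio (D/E → 0) — thin-layer phenomenology / condensation into x₁-sheared or planar-type large scales; implied by the zeroth law at this force and by 28613
sources: doi:10.1017/jfm.2017.293, doi:10.1103/PhysRevFluids.2.054604, doi:10.1017/S0022112096001294, doi:10.1103/PhysRevE.89.023004, doi:10.1088/0169-5983/48/6/061425, doi:10.5890/jand.2019.12.007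
[crux] (lens-4 g6 «FractionOrLoud», DECLARED RESIDUAL in SCALE-FREE trajectory currency; crit-1
CLEARED 2026-08-30T06:22:50Z) R° ThreeDFractionOrLoud: for some φ₀, η > 0 and viscosities 0 < ν_j ≤
1, ν_j → 0, every j admits a global Leray–Hopf solution u_j of NS_ν_j(f), f = sin(4πx₁)e₀ =
stokesMode (0,2,0) e₀ sin, OF ANY ENERGY, lying OUTSIDE the relative normal form «quiet ∧ relatively
planar»: RELATIVELY THREE-DIMENSIONAL (0 < defect and φ₀·meanEnergy ≤ defect, i.e. 3-D energy
fraction ≥ φ₀; defect = mean L²-energy outside the nearest oblique Fourier plane n k₀ + m k₂ = 0) OR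
LOUD in ratio (η·meanEnergy < meanDissipation). NO ν-UNIFORM ENERGY BOUND is quantified — the energy
hard core (census GPMeanBoundedFamily) has LEFT the residual (crit-1: correct in the precise sense
that neither H_R nor R° quantifies an energy bound; the ratio floor forces the energy ceiling inside
RatioUpgrade 23805, M). KERNEL-NECESSARY: ZerothLawAt f → 28613 BoundedThreeDOrLoud → R°
(threeDFractionOrLoud_of_boundedThreeDOrLoud: φ₀ ↦ φ₀/max E₀ 1 and forget the bound;
threeDFractionOrLoud_of_zerothLawAt; cell node file HOME/decomp-ad-lens-4/g6/FractionOrLoud.lean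
sha256 4322b2b7…, rc0 · 0 sorry), hence WEAK -/
@[route_item "route-AnomalousDissipation-SymmetricOrLoud", crux]
def ThreeDFractionOrLoud : Prop :=
  ∃ (φ₀ η : ℝ), 0 < φ₀ ∧ 0 < η ∧ ∃ (ν : ℕ → ℝ), (∀ j, 0 < ν j) ∧ (∀ j, ν j ≤ 1) ∧ Filter.Tendsto ν Filter.atTop (nhds 0) ∧ ∀ j, ∃ (u₀ : UnitAddTorus (Fin 3) → EuclideanSpace ℝ (Fin 3)) (u : ℝ → UnitAddTorus (Fin 3) → EuclideanSpace ℝ (Fin 3)), Literature.Analysis.FluidPDE.Torus.IsGlobalLerayHopf (ν j) (fun _ => ⇑(Literature.Analysis.FluidPDE.Torus.stokesMode (![0, 2, 0] : Fin 3 → ℤ) (EuclideanSpace.single (0 : Fin 3) (1 : ℝ)) false)) u₀ u ∧ ((0 < Literature.Analysis.FluidPDE.longTimeAvgSup (fun t => ⨅ p : {p : ℤ × ℤ // p ≠ 0}, (1 / 2 : ℝ) * ∫ s in (0 : ℝ)..1, ∫ x, ‖u t (x + Literature.Analysis.FluidPDE.toTorus (fun i => s * (![((p.1.1 : ℤ)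 : ℝ), 0, ((p.1.2 : ℤ) : ℝ)] : Fin 3 → ℝ) i)) - u t x‖ ^ 2) ∧ φ₀ * Literature.Analysis.FluidPDE.meanEnergy u ≤ Literature.Analysis.FluidPDE.longTimeAvgSup (fun t => ⨅ p : {p : ℤ × ℤ // p ≠ 0}, (1 / 2 : ℝ) * ∫ s in (0 : ℝ)..1, ∫ x, ‖u t (x + Literature.Analysis.FluidPDE.toTorus (fun i => s * (![((p.1.1 : ℤ) : ℝ), 0, ((p.1.2 : ℤ) : ℝ)] : Fin 3 → ℝ) i)) - u t x‖ ^ 2)) ∨ η * Literature.Analysis.FluidPDE.meanEnergy u < Literature.Analysis.FluidPDE.meanDissipation (ν j) u)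

-- parent: ThreeDFractionOrLoud · child (gen 1)
/--     item stmt-AnomalousDissipation-30314 · crux · rank 301 · open
    parent: ThreeDFractionOrLoud · by planner
    why it might fail: A planar zero-momentum state of NS_nu(f) that is transversally Lyapunov-stable at arbitrarily small nu (time dependence or 2-D condensation with weak strain can stabilise), or the fraction threshold c0 failing to be uniform over planar data of all energies.
    sources: doi:10.1017/jfm.2017.293, doi:10.1007/s00220-006-1526-7, doi:10.1002/1097-0312(200009)53:9<1067::aid-cpa1>3.0.co;2-q, doi:10.1016/0021-8928(62)90149-1, doi:10.1017/S0022112096001310, doi:10.1088/0169-5983/48/6/061425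
[crux] P1 PLANAR STATES EJECT (lens-4 g7 PlanarEjection, first child of the split of the residual
29278 ThreeDFractionOrLoud; MECHANISM piece): there are c0 > 0 and nu0 > 0 such that for every 0 <
nu <= nu0, every p = (n,m) != 0 and every datum v0 that is PLANAR ALONG p (invariant under all
shifts s(n,0,m)), has zero momentum, is L2, non-zero and admits a global Leray-Hopf solution of
NS_nu(sin(4 pi x1) e0), and every eps > 0, there are an L2 datum u0 with ||u0 - v0||^2 <= eps
||v0||^2, a global Leray-Hopf solution u from u0 and a time t >= 0 at which the THREE-DIMENSIONAL
ENERGY FRACTION is >= c0: 0 < defect(u t) and c0 ||u t||^2 <= defect(u t) (defect = instantaneous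
form of the lineage blob = L2-energy outside the nearest oblique Fourier plane). In words: at small
viscosity no planar (2-D / 2.5-D) state of the Kolmogorov flow k_f = 2, of ANY energy, is
transversally stable in the scale-free metric, uniformly in nu. NOT implied by S or ZerothLawAt f,
implies neither; UNDECIDED(T-TRANSV) + IDEA-NEEDED (uniform-in-nu nonlinear transverse instability
of 2-D Kolmogorov turbulence); NON-VACUOUS given aside 28615 (kernel laminar_inhabits_hypotheses:
the laminar datum of energy 1/(512 p -/
@[route_item "route-AnomalousDissipation-SymmetricOrLoud"]
def PlanarStatesEject : Prop :=
  ∃ c₀ : ℝ, 0 < c₀ ∧ ∃ ν₀ : ℝ, 0 < ν₀ ∧ ∀ ν : ℝ, 0 < ν → ν ≤ ν₀ → ∀ p : ℤ × ℤ, p ≠ 0 → ∀ v₀ : UnitAddTorus (Fin 3) → EuclideanSpace ℝ (Fin 3), (∃ v : ℝ → UnitAddTorus (Fin 3) → EuclideanSpace ℝ (Fin 3), Literature.Analysis.FluidPDE.Torus.IsGlobalLerayHopf ν (fun _ => ⇑(Literature.Analysis.FluidPDE.Torus.stokesMode (![0, 2, 0] : Fin 3 → ℤ) (EuclideanSpace.single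 (0 : Fin 3) (1 : ℝ)) false)) v₀ v) → MeasureTheory.MemLp v₀ 2 MeasureTheory.volume → Literature.Analysis.FunctionSpaces.Torus.HasZeroMean v₀ → (∀ (s : ℝ) (x : UnitAddTorus (Fin 3)), v₀ (x + Literature.Analysis.FluidPDE.toTorus (fun i => s * (![((p.1 : ℤ) : ℝ), 0, ((p.2 : ℤ) : ℝ)] : Fin 3 → ℝ) i)) = v₀ x) → 0 < ∫ x, ‖v₀ x‖ ^ 2 → ∀ ε : ℝ, 0 < ε → ∃ (u₀ : UnitAddTorus (Fin 3) → EuclideanSpace ℝ (Fin 3)) (u : ℝ → UnitAddTorus (Fin 3) → EuclideanSpace ℝ (Fin 3)), Literature.Analysis.FluidPDE.Torus.IsGlobalLerayHopf ν (fun _ => ⇑(Literature.Analysis.FluidPDE.Torus.stokesMode (![0, 2, 0] : Fin 3 → ℤ) (EuclideanSpace.single (0 : Fin 3) (1 : ℝ)) false)) u₀ u ∧ MeasureTheory.MemLp u₀ 2 MeasureTheory.volume ∧ ∫ x, ‖u₀ x - v₀ x‖ ^ 2 ≤ ε * ∫ x, ‖v₀ x‖ ^ 2 ∧ ∃ t :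 ℝ, 0 ≤ t ∧ 0 < (⨅ q : {q : ℤ × ℤ // q ≠ 0}, (1 / 2 : ℝ) * ∫ s in (0 : ℝ)..1, ∫ x, ‖u t (x + Literature.Analysis.FluidPDE.toTorus (fun i => s * (![((q.1.1 : ℤ) : ℝ), 0, ((q.1.2 : ℤ) : ℝ)] : Fin 3 → ℝ) i)) - u t x‖ ^ 2) ∧ c₀ * ∫ x, ‖u t x‖ ^ 2 ≤ (⨅ q : {q : ℤ × ℤ // q ≠ 0}, (1 / 2 : ℝ) * ∫ s in (0 : ℝ)..1, ∫ x, ‖u t (x + Literature.Analysis.FluidPDE.toTorus (fun i => s * (![((q.1.1 : ℤ) : ℝ), 0, ((q.1.2 : ℤ) : ℝ)] : Fin 3 → ℝ) i)) - u t x‖ ^ 2)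

-- parent: ThreeDFractionOrLoud · child (gen 1)
/--     item stmt-AnomalousDissipation-30315 · crux · rank 302 · open
    parent: ThreeDFractionOrLoud · by planner
    why it might fail: W_recapture: on-off intermittency of the 3-D component with duty cycle -> 0 as nu -> 0 — trajectories eject but spend asymptotically all energy-weighted time near the planar class, quietly (D/E -> 0), so no family keeps a mean 3-D fraction or a dissipation rate.
    sources: doi:10.1017/jfm.2017.293, doi:10.1103/PhysRevE.103.053102, arXiv:2012.12637, arXiv:2102.08832, doi:10.1103/PhysRevE.89.023004, doi:10.1017/S0022112096001310
[crux] X EJECTION PERSISTS — DECLARED RESIDUAL of lens-4 g7 (second child of the split of 29278):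
(PlanarStatesEject-text) -> (ThreeDFractionOrLoud-text), both inlined (Iff.rfl-identical to
PlanarStatesEject -> ThreeDFractionOrLoud; kernel certificate ejectionPersists_text_iff in
HOME/decomp-ad-lens-4/g7/PlanarEjection.lean). Content: in a world where planar states eject, SOME
Leray-Hopf family along nu_j -> 0 is NOT RE-CAPTURED IN MEAN — it keeps a mean 3-D energy fraction
>= phi0 with positive defect, or dissipates at rate >= eta * energy. KERNEL-WEAKER than 29278
(ThreeDFractionOrLoud => X, one line), hence than 28613 and than ZerothLawAt f (kernel chain
re-proved in the node file: X is necessary for the zeroth law at this force); STRICTLY weaker in the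
separating world W_stable-planar = PlanarStatesEject false and 29278 false (not X <-> P1 and not R°,
kernel). INSTRUMENTABLE(T-BURST: duty cycle of 3-D bursts along the nu-ladder) + IDEA-NEEDED (no
re-capture in mean). Thick-layer phenomenology for it: Q = (2 pi/H)/k_f = 1/2 fixed < Q_3D ~ 3.6
while Re -> infinity; exact two-dimensionalisation only for Re <= (Q/1.16)^2; on-off intermittency
only near H_2D ~ l_f Re^(-1/2) -> 0. -/
@[route_item "route-AnomalousDissipation-SymmetricOrLoud"]
def EjectionPersists : Prop :=
  (∃ c₀ : ℝ, 0 < c₀ ∧ ∃ ν₀ : ℝ, 0 < ν₀ ∧ ∀ ν : ℝ, 0 < ν → ν ≤ ν₀ → ∀ p : ℤ × ℤ, p ≠ 0 → ∀ v₀ : UnitAddTorus (Fin 3) → EuclideanSpace ℝ (Fin 3), (∃ v : ℝ → UnitAddTorus (Fin 3) → EuclideanSpace ℝ (Fin 3), Literature.Analysis.FluidPDE.Torus.IsGlobalLerayHopf ν (fun _ => ⇑(Literature.Analysis.FluidPDE.Torus.stokesMode (![0, 2, 0] : Fin 3 → ℤ) (EuclideanSpace.single (0 : Fin 3) (1 :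 ℝ)) false)) v₀ v) → MeasureTheory.MemLp v₀ 2 MeasureTheory.volume → Literature.Analysis.FunctionSpaces.Torus.HasZeroMean v₀ → (∀ (s : ℝ) (x : UnitAddTorus (Fin 3)), v₀ (x + Literature.Analysis.FluidPDE.toTorus (fun i => s * (![((p.1 : ℤ) : ℝ), 0, ((p.2 : ℤ) : ℝ)] : Fin 3 → ℝ) i)) = v₀ x) → 0 < ∫ x, ‖v₀ x‖ ^ 2 → ∀ ε : ℝ, 0 < ε → ∃ (u₀ : UnitAddTorus (Fin 3) → EuclideanSpace ℝ (Fin 3)) (u : ℝ → UnitAddTorus (Fin 3) → EuclideanSpace ℝ (Fin 3)), Literature.Analysis.FluidPDE.Torus.IsGlobalLerayHopf ν (fun _ => ⇑(Literature.Analysis.FluidPDE.Torus.stokesMode (![0, 2, 0] : Fin 3 → ℤ) (EuclideanSpace.single (0 : Fin 3) (1 : ℝ)) false)) u₀ u ∧ MeasureTheory.MemLp u₀ 2 MeasureTheory.volume ∧ ∫ x, ‖u₀ x - v₀ x‖ ^ 2 ≤ ε * ∫ x, ‖v₀ x‖ ^ 2 ∧ ∃ t : ℝ, 0 ≤ t ∧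 0 < (⨅ q : {q : ℤ × ℤ // q ≠ 0}, (1 / 2 : ℝ) * ∫ s in (0 : ℝ)..1, ∫ x, ‖u t (x + Literature.Analysis.FluidPDE.toTorus (fun i => s * (![((q.1.1 : ℤ) : ℝ), 0, ((q.1.2 : ℤ) : ℝ)] : Fin 3 → ℝ) i)) - u t x‖ ^ 2) ∧ c₀ * ∫ x, ‖u t x‖ ^ 2 ≤ (⨅ q : {q : ℤ × ℤ // q ≠ 0}, (1 / 2 : ℝ) * ∫ s in (0 : ℝ)..1, ∫ x, ‖u t (x + Literature.Analysis.FluidPDE.toTorus (fun i => s * (![((q.1.1 : ℤ) : ℝ), 0, ((q.1.2 : ℤ) : ℝ)] : Fin 3 → ℝ) i)) - u t x‖ ^ 2)) → (∃ (φ₀ η : ℝ), 0 < φ₀ ∧ 0 < η ∧ ∃ (ν : ℕ → ℝ), (∀ j, 0 < ν j) ∧ (∀ j, ν j ≤ 1) ∧ Filter.Tendsto ν Filter.atTop (nhds 0) ∧ ∀ j, ∃ (u₀ : UnitAddTorus (Fin 3) → EuclideanSpace ℝ (Fin 3)) (u : ℝ → UnitAddTorus (Fin 3) → EuclideanSpace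 ℝ (Fin 3)), Literature.Analysis.FluidPDE.Torus.IsGlobalLerayHopf (ν j) (fun _ => ⇑(Literature.Analysis.FluidPDE.Torus.stokesMode (![0, 2, 0] : Fin 3 → ℤ) (EuclideanSpace.single (0 : Fin 3) (1 : ℝ)) false)) u₀ u ∧ ((0 < Literature.Analysis.FluidPDE.longTimeAvgSup (fun t => ⨅ p : {p : ℤ × ℤ // p ≠ 0}, (1 / 2 : ℝ) * ∫ s in (0 : ℝ)..1, ∫ x, ‖u t (x + Literature.Analysis.FluidPDE.toTorus (fun i => s * (![((p.1.1 : ℤ) : ℝ), 0, ((p.1.2 : ℤ) : ℝ)] : Fin 3 → ℝ) i)) - u t x‖ ^ 2) ∧ φ₀ * Literature.Analysis.FluidPDE.meanEnergy u ≤ Literature.Analysis.FluidPDE.longTimeAvgSup (fun t => ⨅ p : {p : ℤ × ℤ // p ≠ 0}, (1 / 2 : ℝ) * ∫ s in (0 : ℝ)..1, ∫ x, ‖u t (x + Literature.Analysis.FluidPDE.toTorus (fun i => s * (![((p.1.1 : ℤ) : ℝ), 0, ((p.1.2 : ℤ) : ℝ)] : Fin 3 → ℝ) i)) - u t x‖ ^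 2)) ∨ η * Literature.Analysis.FluidPDE.meanEnergy u < Literature.Analysis.FluidPDE.meanDissipation (ν j) u))

-- parent: ThreeDFractionOrLoud · glue (gen 1)
/--     item stmt-AnomalousDissipation-30316 · support · rank 303 · closed · proved by Summit.AnomalousDissipation.AnomalousDissipation.Theorems.PlanarEjectionGlue.threeDFractionOrLoudGlue_holds (prover)
    parent: ThreeDFractionOrLoud · GLUE: children ⟹ parent · by planner
PlanarStatesEject → EjectionPersists → ThreeDFractionOrLoud (modus ponens; kernel
threeDFractionOrLoud_of_split in the cell node file HOME/decomp-ad-lens-4/g7/PlanarEjection.lean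
l.281) -/
@[route_item "route-AnomalousDissipation-SymmetricOrLoud"]
def ThreeDFractionOrLoudGlue : Prop :=
  PlanarStatesEject → EjectionPersists → ThreeDFractionOrLoud

-- `ThreeDFractionOrLoudGlue` holds: proved by `Summit.AnomalousDissipation.AnomalousDissipation.Theorems.PlanarEjectionGlue.threeDFractionOrLoudGlue_holds` (its module imports this route file, so no `_holds` link can be stated here).

/-- item stmt-AnomalousDissipation-23805 · crux · rank 4 · open · by planner
why it might fail: only via limsup junk values (meanEnergy/meanDissipation default to 0 for unbounded Cesàro means), excluded at fixed ν > 0 by Torus.IsGlobalLerayHopf.timeMean_norm_sq_le; the j-uniform floor needs the amplitude bound for a general smooth force (shape f/‖f‖₂, n = 1).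
sources: DoeringFoias2002, CheskidovDoeringPetrov2006, Frisch1995
[crux] the rate-per-energy form of the zeroth law (some smooth divergence-free mean-zero steady
force, some θ > 0, ν_j → 0, global Leray–Hopf solutions with θ·meanEnergy(u_j) <
meanDissipation(ν_j,u_j)) implies AnomalousDissipation: the energy bound comes from meanDissipation
≤ ‖f‖₂·√meanEnergy, the floor from the Doering–Foias amplitude bound (meanEnergy ≥ c(f) > 0 for ν ≤
1, f ≠ 0 being forced by the strict ratio inequality). [difficulty: M] -/
@[route_item "route-AnomalousDissipation-SymmetricOrLoud", crux]
def RatioUpgrade : Prop :=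
  (∃ f : UnitAddTorus (Fin 3) → EuclideanSpace ℝ (Fin 3), Literature.Analysis.FunctionSpaces.Torus.IsSmooth f ∧ Literature.Analysis.FunctionSpaces.Torus.IsDivFree f ∧ Literature.Analysis.FunctionSpaces.Torus.HasZeroMean f ∧ ∃ θ : ℝ, 0 < θ ∧ ∃ (ν : ℕ → ℝ) (u₀ : ℕ → UnitAddTorus (Fin 3) → EuclideanSpace ℝ (Fin 3)) (u : ℕ → ℝ → UnitAddTorus (Fin 3) → EuclideanSpace ℝ (Fin 3)), (∀ j, 0 < ν j) ∧ Filter.Tendsto ν Filter.atTop (nhds 0) ∧ (∀ j, Literature.Analysis.FluidPDE.Torus.IsGlobalLerayHopf (ν j) (fun _ => f) (u₀ j) (u j)) ∧ ∀ j, θ * Literature.Analysis.FluidPDE.meanEnergy (u j) < Literature.Analysis.FluidPDE.meanDissipation (ν j) (u j)) → _root_.AnomalousDissipation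

/-- item stmt-AnomalousDissipation-26489 · aside · rank 2 · open · by planner
why it might fail: a sustained quiet-yet-asymmetric bounded state at small ν — e.g. a quasi-two-dimensional condensate carrying O(1) energy in k₂ ≠ 0 modes with ν‖∇u‖² → 0 (thin-layer flows without drag show 2D/3D coexistence near H ≈ ℓ_f/2) — refutes it.
sources: doi:10.1017/jfm.2012.524, arXiv:1808.06186, doi:10.1017/jfm.2017.293, doi:10.1103/PhysRevLett.66.2204, doi:10.1063/1.858144, AlexakisDoering2006
[crux] (RIGIDITY INPUT of the lens-4 dichotomy — not implied by the zeroth law S nor by S restricted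
to this force; its refutation closes the route and says nothing about S; its non-costume status is
CONDITIONAL on the cell aside PlanarSaturation = instrument test T-2D, UNDECIDED at filing) for
every E₀ there is θ₀ > 0 such that for 0 < ν ≤ 1 every stationary Leray–Hopf trajectory law of
NS_ν(sin(4πx₁)e₀) — standard Borel probability space (Ω,P), P-preserving S intertwining the unit
time shift, weakly measurable pairings, EVERY path a global Leray–Hopf solution with zero momentum,
meanEnergy ≤ E₀ and meanDissipation ≤ θ₀·meanEnergy — is almost surely carried by symmetric fields:
for P-a.e. ω there is v ≠ 0 with f(·+v) = f and traj ω t (·+v) = traj ω t a.e. on T³ for all t ≥ 0.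
TYPING NOTE: «symmetric» = invariant under SOME non-trivial translation symmetry of f, which
includes the discrete shift (0,½,0) and rational (v₀,0,v₂) (periodically refined 3-D states), not
only planar x₂-invariant states; only the continuously symmetric (planar) laws are provably quiet
(not_twohalfdThesis_stokesEigenfield). Birth skeleton (evidence): stub_quietImpliesPlanar (transfer
C⁺ = a.s. planar, small -/
@[route_item "route-AnomalousDissipation-SymmetricOrLoud"]
def QuietLawsAreSymmetric : Prop :=
  ∀ E₀ : ℝ, ∃ θ₀ : ℝ, 0 < θ₀ ∧ ∀ ν : ℝ, 0 < ν → ν ≤ 1 → ∀ (Ω : Type) [MeasurableSpace Ω] [StandardBorelSpace Ω] (P : MeasureTheory.Measure Ω) [MeasureTheory.IsProbabilityMeasure P] (S : Ω → Ω) (traj : Ω → ℝ → UnitAddTorus (Fin 3) → EuclideanSpace ℝ (Fin 3)), MeasureTheory.MeasurePreserving S P P → (∀ ω t, traj (S ω) t = traj ω (t + 1)) → (∀ (t : ℝ) (g : UnitAddTorus (Fin 3) → EuclideanSpace ℝ (Fin 3)), MeasureTheory.MemLp g 2 MeasureTheory.volume → Measurable fun ω => ∫ x, inner ℝ (traj ω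 t x) (g x)) → (∀ ω, Literature.Analysis.FluidPDE.Torus.IsGlobalLerayHopf ν (fun _ => ⇑(Literature.Analysis.FluidPDE.Torus.stokesMode (![0, 2, 0] : Fin 3 → ℤ) (EuclideanSpace.single (0 : Fin 3) (1 : ℝ)) false)) (traj ω 0) (traj ω)) → (∀ ω t, 0 ≤ t → Literature.Analysis.FunctionSpaces.Torus.HasZeroMean (traj ω t)) → (∀ ω, Literature.Analysis.FluidPDE.meanEnergy (traj ω) ≤ E₀) → (∀ ω, Literature.Analysis.FluidPDE.meanDissipation ν (traj ω) ≤ θ₀ * Literature.Analysis.FluidPDE.meanEnergy (traj ω)) → ∀ᵐ ω ∂P, ∃ v : UnitAddTorus (Fin 3), v ≠ 0 ∧ (∀ x, Literature.Analysis.FluidPDE.Torus.stokesMode (![0, 2, 0] : Fin 3 → ℤ) (EuclideanSpace.single (0 : Fin 3) (1 : ℝ)) false (x + v) = Literature.Analysis.FluidPDE.Torus.stokesMode (![0, 2, 0] : Fin 3 → ℤ) (EuclideanSpace.single (0 : Fin 3) (1 : ℝ)) false x) ∧ ∀ t : ℝ, 0 ≤ t → (fun x => traj ω t (x + v)) =ᵐ[MeasureTheory.volume]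 traj ω t

/-- item stmt-AnomalousDissipation-28182 · aside · rank 2 · open · by planner
why it might fail: a quiet-yet-robustly-3-D bounded state at small ν (3-D steady state / attractor fed at rate D → 0 but holding O(1) energy off every oblique plane n·k₀+m·k₂=0: thin-layer 2D/3D coexistence without drag) refutes it; killable by DNS (T-3D-SYM-defect) or Newton continuation off the planar branch
sources: doi:10.1103/PhysRevLett.66.2204, doi:10.1063/1.858144, doi:10.1017/jfm.2017.293, doi:10.1017/jfm.2012.524, arXiv:1808.06186, AlexakisDoering2006
[crux] (NEAR-RIGIDITY INPUT of the lens-4 dichotomy, generation 4; replaces 26489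
QuietLawsAreSymmetric for staffing after the lineage's self-objection: exact a.s. symmetry of ALL
quiet bounded laws, Dirac / periodic-orbit laws included, is costume-or-false — transverse
bifurcations off the quiet bounded planar condensate give quiet, bounded, genuinely 3-D steady /
periodic laws with SMALL symmetry defect; not implied by the zeroth law S nor by S at this force;
its refutation closes the line and says nothing about S; leaf UNDECIDED(census T-3D-SYM-defect) +
IDEA-NEEDED; costume-risk confined to the slice V = 0 in the world without quiet bounded
zero-momentum states — for V ≠ 0 the exempted class is INHABITED unconditionally by the drift states
u = V e₁ + α sin(4πx₁)e₀ + β cos(4πx₁)e₀, α = ν/Δ, β = −V/(4πΔ), Δ = V² + 16π²ν², energy → V² +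
1/(32π²V²), dissipation ν/(2Δ) → 0, defect 0, kernel-certified in the cell node file
HOME/decomp-ad-lens-4/g4/NearSymmetricOrLoud.lean: drift_coefficients, symDefect_driftField,
driftStates_quiet_bounded) QUIET STATIONARY STATISTICS ARE NEARLY SYMMETRIC: for all V̄, E₀ and δ >
0 there is θ₀ > 0 such that for 0 < ν ≤ 1 and every momentum |V| ≤ V̄ (θ -/
@[route_item "route-AnomalousDissipation-SymmetricOrLoud"]
def QuietLawsAreNearlySymmetric : Prop :=
  ∀ Vb E₀ δ : ℝ, 0 < δ → ∃ θ₀ : ℝ, 0 < θ₀ ∧ ∀ ν : ℝ, 0 < ν → ν ≤ 1 → ∀ V : ℝ, |V| ≤ Vb → ∀ (Ω : Type) [MeasurableSpace Ω] [StandardBorelSpace Ω] (P : MeasureTheory.Measure Ω) [MeasureTheory.IsProbabilityMeasure P] (S : Ω → Ω) (traj : Ω → ℝ → UnitAddTorus (Fin 3) → EuclideanSpace ℝ (Fin 3)), MeasureTheory.MeasurePreserving S P P → (∀ ω t, traj (S ω) t = traj ω (t + 1)) → (∀ (t : ℝ) (g : UnitAddTorus (Fin 3) → EuclideanSpace ℝ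 (Fin 3)), MeasureTheory.MemLp g 2 MeasureTheory.volume → Measurable fun ω => ∫ x, inner ℝ (traj ω t x) (g x)) → (∀ ω, Literature.Analysis.FluidPDE.Torus.IsGlobalLerayHopf ν (fun _ => ⇑(Literature.Analysis.FluidPDE.Torus.stokesMode (![0, 2, 0] : Fin 3 → ℤ) (EuclideanSpace.single (0 : Fin 3) (1 : ℝ)) false)) (traj ω 0) (traj ω)) → (∀ ω t, 0 ≤ t → Literature.Analysis.FunctionSpaces.Torus.HasZeroMean (fun x => traj ω t x - V • EuclideanSpace.single (1 : Fin 3) (1 : ℝ))) → (∀ ω, Literature.Analysis.FluidPDE.meanEnergy (traj ω) ≤ E₀) → (∀ ω, Literature.Analysis.FluidPDE.meanDissipation ν (traj ω) ≤ θ₀ * Literature.Analysis.FluidPDE.meanEnergy (traj ω)) → ∀ᵐ ω ∂P, Literature.Analysis.FluidPDE.longTimeAvgSup (fun t => ⨅ p : {p : ℤ × ℤ // p ≠ 0}, (1 / 2 : ℝ) * ∫ s in (0 : ℝ)..1, ∫ x, ‖traj ω t (x + Literature.Analysis.FluidPDE.toTorus (fun i => s * (![((p.1.1 : ℤ) : ℝ),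 0, ((p.1.2 : ℤ) : ℝ)] : Fin 3 → ℝ) i)) - traj ω t x‖ ^ 2) ≤ δ

/-- item stmt-AnomalousDissipation-28612 · aside · rank 2 · open · by planner
why it might fail: one quiet-yet-robustly-3-D bounded trajectory at small ν refutes it: a 3-D steady/recurrent state continued from a forced-Euler steady state with ∫f·U = 0 (D/E → 0, O(1) energy off every oblique plane), or 2D/3D transients with O(1) limsup defect; killable by DNS / Galerkin-refinement root hunts
sources: doi:10.1103/PhysRevLett.66.2204, doi:10.1063/1.858144, doi:10.1017/jfm.2017.293, doi:10.1017/jfm.2012.524, arXiv:1808.06186, AlexakisDoering2006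
[crux] H_T — NEAR-RIGIDITY OF QUIET TRAJECTORIES (generation-5 reduction theorem of the lens-4
«minimal counterexample» line, TRAJECTORY currency: no law, no momentum clause — momentum is
conserved and |momentum|² ≤ meanEnergy; DICHOTOMY INPUT, not implied by the zeroth law S nor by S at
this force; STRONGER than 28182 QuietLawsAreNearlySymmetric, which it kernel-implies for every
momentum window (cell file HOME/decomp-ad-lens-4/g5/ThreeDOrLoud.lean
`quietLaws_of_quietTrajectories`) — deliberately: the trajectory→law dictionary burden is moved from
the residual into the input; NON-VACUOUS UNCONDITIONALLY: the explicit drift states u = V e₁ + α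
sin(4πx₁)e₀ + β cos(4πx₁)e₀, α = ν/Δ, β = −V/(4πΔ), Δ = V² + 16π²ν² (energy V² + 1/(32π²Δ),
dissipation ν/(2Δ), defect 0) meet every hypothesis at E₀ ≥ V² + 1/(32π²V²) (minimum 1/(2√2π) ≈
0.113) for EVERY θ₀ once ν ≤ 2θ₀V⁴ — kernel `exemption_inhabited` given the aside
DriftStatesAreLerayHopf — so no ∀-floor «meanDissipation ≥ θ₀·meanEnergy on bounded trajectories»
holds at this force; tags UNDECIDED(census T-3D-SYM-defect, trajectory reading) + IDEA-NEEDED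
(quantitative hydrodynamic stability; structure a proof must explain = the mean shear- -/
@[route_item "route-AnomalousDissipation-SymmetricOrLoud"]
def QuietTrajectoriesNearlySymmetric : Prop :=
  ∀ E₀ δ : ℝ, 0 < δ → ∃ θ₀ : ℝ, 0 < θ₀ ∧ ∀ ν : ℝ, 0 < ν → ν ≤ 1 → ∀ (u₀ : UnitAddTorus (Fin 3) → EuclideanSpace ℝ (Fin 3)) (u : ℝ → UnitAddTorus (Fin 3) → EuclideanSpace ℝ (Fin 3)), Literature.Analysis.FluidPDE.Torus.IsGlobalLerayHopf ν (fun _ => ⇑(Literature.Analysis.FluidPDE.Torus.stokesMode (![0, 2, 0] : Fin 3 → ℤ) (EuclideanSpace.single (0 : Fin 3) (1 : ℝ)) false)) u₀ u → Literature.Analysis.FluidPDE.meanEnergy u ≤ E₀ → Literature.Analysis.FluidPDE.meanDissipation ν u ≤ θ₀ * Literature.Analysis.FluidPDE.meanEnergy u → Literature.Analysis.FluidPDE.longTimeAvgSup (fun t => ⨅ p : {p : ℤ × ℤ // p ≠ 0}, (1 / 2 : ℝ) * ∫ s in (0 : ℝ)..1, ∫ x, ‖u t (x + Literature.Analysis.FluidPDE.toTorus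 (fun i => s * (![((p.1.1 : ℤ) : ℝ), 0, ((p.1.2 : ℤ) : ℝ)] : Fin 3 → ℝ) i)) - u t x‖ ^ 2) ≤ δ

/-- item stmt-AnomalousDissipation-26490 · aside · rank 3 · SPLIT (gen 1) into BoundedZMLaws, StreamwiseSymmetryUnbounded, NoPlanarTypeRelaxation + glue AsymmetricBoundedLawsGlue · direct attempts still welcome (low priority) · by planner
why it might fail: the ν-uniform mean-energy bound at fixed force is the hard-core energy axis (GPMeanBoundedFamily); independently, 3-D statistics could relax to planar ones at bounded energy as ν → 0 (inverse-cascade two-dimensionalisation).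
sources: ConstantinTarfuleaVicol2013, DoeringFoias2002, doi:10.1017/jfm.2017.293, doi:10.1103/PhysRevFluids.2.054604, FoiasManleyRosaTemam2001
[crux] (declared RESIDUAL; operatively necessary for S at this force MODULO REFINEMENT — a loud
bounded law invariant under a discrete symmetry of f would satisfy S without it) there are E₀,
viscosities 0 < ν_j ≤ 1 with ν_j → 0 and, for every j, a stationary Leray–Hopf trajectory law of
NS_ν_j(sin(4πx₁)e₀) in the format of QuietLawsAreSymmetric, all paths with zero momentum and
meanEnergy ≤ E₀, which is NOT almost surely symmetric (under any non-trivial translation symmetry of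
f, continuous or discrete) — sustained spontaneous breaking of the force's translation symmetry
(genuinely three-dimensional, non-refined statistics) at bounded energy survives the
vanishing-viscosity limit; no dissipation floor is asked. Barrier: energy hard core
(GPMeanBoundedFamily, census 15509) for the bounded-energy half. [difficulty: open-problem] -/
@[route_item "route-AnomalousDissipation-SymmetricOrLoud"]
def AsymmetricBoundedLaws : Prop :=
  ∃ (E₀ : ℝ) (ν : ℕ → ℝ), (∀ j, 0 < ν j) ∧ (∀ j, ν j ≤ 1) ∧ Filter.Tendsto ν Filter.atTop (nhds 0) ∧ ∀ j, ∃ (Ω : Type) (_ : MeasurableSpace Ω) (_ : StandardBorelSpace Ω) (P : MeasureTheory.Measure Ω) (_ : MeasureTheory.IsProbabilityMeasure P) (S : Ω → Ω) (traj : Ω → ℝ → UnitAddTorus (Fin 3) → EuclideanSpace ℝ (Fin 3)), MeasureTheory.MeasurePreserving S P P ∧ (∀ ω t, traj (S ω) t = traj ω (t + 1)) ∧ (∀ (t : ℝ) (g : UnitAddTorus (Fin 3) → EuclideanSpace ℝ (Fin 3)), MeasureTheory.MemLp g 2 MeasureTheory.volume → Measurable fun ω => ∫ x, inner ℝ (traj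 ω t x) (g x)) ∧ (∀ ω, Literature.Analysis.FluidPDE.Torus.IsGlobalLerayHopf (ν j) (fun _ => ⇑(Literature.Analysis.FluidPDE.Torus.stokesMode (![0, 2, 0] : Fin 3 → ℤ) (EuclideanSpace.single (0 : Fin 3) (1 : ℝ)) false)) (traj ω 0) (traj ω)) ∧ (∀ ω t, 0 ≤ t → Literature.Analysis.FunctionSpaces.Torus.HasZeroMean (traj ω t)) ∧ (∀ ω, Literature.Analysis.FluidPDE.meanEnergy (traj ω) ≤ E₀) ∧ ¬ (∀ᵐ ω ∂P, ∃ v : UnitAddTorus (Fin 3), v ≠ 0 ∧ (∀ x, Literature.Analysis.FluidPDE.Torus.stokesMode (![0, 2, 0] : Fin 3 → ℤ) (EuclideanSpace.single (0 : Fin 3) (1 : ℝ)) false (x + v) = Literature.Analysis.FluidPDE.Torus.stokesMode (![0, 2, 0] : Fin 3 → ℤ) (EuclideanSpace.single (0 : Fin 3) (1 : ℝ)) false x) ∧ ∀ t : ℝ, 0 ≤ t → (fun x => traj ω t (x + v)) =ᵐ[MeasureTheory.volume] traj ω t)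

-- parent: AsymmetricBoundedLaws · child (gen 1)
/--     item stmt-AnomalousDissipation-27446 · aside · rank 301 · open
    parent: AsymmetricBoundedLaws · by planner
    why it might fail: no ν-uniform bound on the mean energy of ANY stationary statistics at a pinned force is known (laminar and streamwise-symmetric states have energy 1/(512π⁴ν²)); if the 2-D condensate does not saturate (T-2D: ⟨‖u‖²⟩ ∝ ν^{-α}) the only support left is 3-D DNS friction-factor saturation.
    sources: DoeringFoias2002, ConstantinTarfuleaVicol2013, doi:10.1017/jfm.2012.524, doi:10.1017/S0022112096001294, doi:10.1103/PhysRevE.89.023004, FoiasManleyRosaTemam2001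
[crux] (child B of the split of 26490 AsymmetricBoundedLaws; WEAKER, kernel-necessary: drop the
asymmetry clause; leaf BARRIER(energy hard core: ν-uniform mean-energy bound at a pinned force,
GPMeanBoundedFamily census 15509) + IDEA-NEEDED (saturation theorem) + INSTRUMENTABLE (sufficient
planar sub-leaf PlanarBoundedLaws = census T-2D kit j337935 ≈ KLB-2D F2 kit j337587, UNDECIDED at
filing)) there are E₀, viscosities 0 < ν_j ≤ 1 with ν_j → 0 and, for every j, a stationary
Leray–Hopf trajectory law of NS_ν_j(sin(4πx₁)e₀) in the format of QuietLawsAreSymmetric (standard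
Borel (Ω,P), P-preserving S intertwining the unit time shift, weakly measurable pairings, EVERY path
a global Leray–Hopf solution from its own time-zero slice), all paths with zero momentum (t ≥ 0) and
meanEnergy ≤ E₀. Operatively necessary for the zeroth law at this force modulo the trajectory→law
dictionary (LoudWindows items TimeAverageLaw 26822 / lens-3 StationaryLimit). Evidence in print
(instrument-grade, not proof): ν-independent friction factor and O(1) energy of the 3-D Kolmogorov
flow in DNS (Borue–Orszag 1996; Musacchio–Boffetta 2014). -/
@[route_item "route-AnomalousDissipation-SymmetricOrLoud"]
def BoundedZMLaws : Prop :=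
  ∃ (E₀ : ℝ) (ν : ℕ → ℝ), (∀ j, 0 < ν j) ∧ (∀ j, ν j ≤ 1) ∧ Filter.Tendsto ν Filter.atTop (nhds 0) ∧ ∀ j, ∃ (Ω : Type) (_ : MeasurableSpace Ω) (_ : StandardBorelSpace Ω) (P : MeasureTheory.Measure Ω) (_ : MeasureTheory.IsProbabilityMeasure P) (S : Ω → Ω) (traj : Ω → ℝ → UnitAddTorus (Fin 3) → EuclideanSpace ℝ (Fin 3)), MeasureTheory.MeasurePreserving S P P ∧ (∀ ω t, traj (S ω) t = traj ω (t + 1)) ∧ (∀ (t : ℝ) (g : UnitAddTorus (Fin 3) → EuclideanSpace ℝ (Fin 3)), MeasureTheory.MemLp g 2 MeasureTheory.volume → Measurable fun ω => ∫ x, inner ℝ (traj ω t x) (g x)) ∧ (∀ ω, Literature.Analysis.FluidPDE.Torus.IsGlobalLerayHopf (ν j) (fun _ => ⇑(Literature.Analysis.FluidPDE.Torus.stokesMode (![0, 2, 0] : Fin 3 → ℤ) (EuclideanSpace.single (0 : Fin 3) (1 : ℝ)) false)) (traj ω 0) (traj ω)) ∧ (∀ ω t, 0 ≤ t → Literature.Analysis.FunctionSpaces.Torus.HasZeroMean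 (traj ω t)) ∧ (∀ ω, Literature.Analysis.FluidPDE.meanEnergy (traj ω) ≤ E₀)

-- parent: AsymmetricBoundedLaws · child (gen 1)
/--     item stmt-AnomalousDissipation-27447 · aside · rank 302 · open
    parent: AsymmetricBoundedLaws · by planner
    why it might fail: only through weak-solution technology: the reduction «x₀-invariant 3-D Leray–Hopf ⇒ 2½-D Leray–Hopf on T²» and 2-D uniqueness / energy EQUALITY for energy-inequality solutions must be supplied in the tree (Ladyzhenskaya 1959; Lions–Prodi 1959); the statement is classical.
    sources: doi:10.1007/BF01212343, FoiasManleyRosaTemam2001, Temam1977, doi:10.1017/S0022112096001294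
[crux] (child T of the split of 26490; THEOREM-GRADE — true in every world, hence trivially
necessary; WEAKER than S and 26490: a no-go about a thin symmetry class implying no existence
statement; leaf ATTACKABLE-NOW L–XL, CLAIMABLE: doors OrbitClosureStreamwise (M: character duality
for closed subgroups of T³ + closed stabiliser of an a.e.-class) and StreamwiseInvariantUnbounded
(XL: x₀-independent Leray–Hopf solutions are the unique 2½-D solutions — in-plane UNFORCED 2-D
Navier–Stokes decays by the 2-D energy equality (Ladyzhenskaya / Lions–Prodi), streamwise component
relaxes to sin(4πx₁)/(16π²ν); tree engine for the harder forced first-shell 2-D case: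
Literature.Barriers.AnomalousDissipation.GravestModeLaminarAttractor.Marchioro1986_globalAttraction_holds),
kernel skeleton streamwiseSymmetryUnbounded_of and certified constant laminar_energy_exceeds in
HOME/decomp-ad-lens-4/g3/SymmetryTrim.lean; rung ShearSymmetryUnbounded (M–L, heat equation))
STREAMWISE-CLOSING SYMMETRIES ARE UNINHABITED AT BOUNDED ENERGY: for every E₀ there is ν₀ > 0 such
that for 0 < ν ≤ ν₀ every global Leray–Hopf solution u of NS_ν(sin(4πx₁)e₀) with zero momentum for t
≥ 0, whose every time slice u t (t ≥ 0 -/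
@[route_item "route-AnomalousDissipation-SymmetricOrLoud"]
def StreamwiseSymmetryUnbounded : Prop :=
  ∀ E₀ : ℝ, ∃ ν₀ : ℝ, 0 < ν₀ ∧ ∀ ν : ℝ, 0 < ν → ν ≤ ν₀ → ∀ (u₀ : UnitAddTorus (Fin 3) → EuclideanSpace ℝ (Fin 3)) (u : ℝ → UnitAddTorus (Fin 3) → EuclideanSpace ℝ (Fin 3)), Literature.Analysis.FluidPDE.Torus.IsGlobalLerayHopf ν (fun _ => ⇑(Literature.Analysis.FluidPDE.Torus.stokesMode (![0, 2, 0] : Fin 3 → ℤ) (EuclideanSpace.single (0 : Fin 3) (1 : ℝ)) false)) u₀ u → (∀ t : ℝ, 0 ≤ t → Literature.Analysis.FunctionSpaces.Torus.HasZeroMean (u t)) → ∀ v : UnitAddTorus (Fin 3), (∀ c : Fin 3 → ℤ, ∑ i, c i • v i = 0 → c 0 = 0) → (∀ t : ℝ, 0 ≤ t → (fun x => u t (x + v)) =ᵐ[MeasureTheory.volume] u t) → E₀ < Literature.Analysis.FluidPDE.meanEnergy u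

-- parent: AsymmetricBoundedLaws · child (gen 1)
/--     item stmt-AnomalousDissipation-27448 · aside · rank 303 · open
    parent: AsymmetricBoundedLaws · by planner
    why it might fail: inverse-cascade two-dimensionalisation: at bounded energy the vanishing-viscosity statistics of the 3-D Kolmogorov flow could relax onto x₂-invariant (condensate) or half-period-locked states, as layers of depth H ≲ ℓ_f/2 do; no theorem excludes it, attractor/KB limits need not preserve asymmetry.
    sources: doi:10.1017/jfm.2012.524, arXiv:1808.06186, doi:10.1017/jfm.2017.293, doi:10.1103/PhysRevE.89.023004, doi:10.1017/S0022112096001294, doi:10.1063/1.858144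
[crux] (child N of the split of 26490; DECLARED RESIDUAL; WEAKER-formal: implied by 26490 and by
«BoundedZMLaws → 26490» (kernel: noPlanarTypeRelaxation_of_asymmetric / _of_noSymmetricRelaxation),
separated from 26490 by every ¬BoundedZMLaws world, and its conclusion is weaker than 26490's by
exactly the symmetry classes StreamwiseSymmetryUnbounded removes; leaf IDEA-NEEDED (persistence of
three-dimensionality — spontaneous breaking of the force's continuous AND discrete translation
symmetries — at bounded energy in the vanishing-viscosity limit; attractor / Krylov–Bogoliubov
limits do not preserve asymmetry) + INSTRUMENTABLE (census request T-3D-SYM: planar / odd-k₁ /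
streamwise energy fractions vs ν at bounded energy for the 3-D Kolmogorov flow k_f = 2)) NO
RELAXATION TO PLANAR-TYPE STATISTICS: if bounded zero-momentum stationary Leray–Hopf laws of
NS_ν_j(sin(4πx₁)e₀) exist along some ν_j → 0 (BoundedZMLaws), then there are E₀, 0 < ν_j ≤ 1 → 0 and
such laws (same format, zero momentum, meanEnergy ≤ E₀ on every path) that are NOT almost surely of
planar type — it fails that for P-a.e. ω some v ≠ 0 with a RATIONAL STREAMWISE LOCK (Σ cᵢ•vᵢ = 0 for
some c ∈ ℤ³ with c₀ ≠ 0: planar x₂- -/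
@[route_item "route-AnomalousDissipation-SymmetricOrLoud"]
def NoPlanarTypeRelaxation : Prop :=
  BoundedZMLaws → ∃ (E₀ : ℝ) (ν : ℕ → ℝ), (∀ j, 0 < ν j) ∧ (∀ j, ν j ≤ 1) ∧ Filter.Tendsto ν Filter.atTop (nhds 0) ∧ ∀ j, ∃ (Ω : Type) (_ : MeasurableSpace Ω) (_ : StandardBorelSpace Ω) (P : MeasureTheory.Measure Ω) (_ : MeasureTheory.IsProbabilityMeasure P) (S : Ω → Ω) (traj : Ω → ℝ → UnitAddTorus (Fin 3) → EuclideanSpace ℝ (Fin 3)), MeasureTheory.MeasurePreserving S P P ∧ (∀ ω t, traj (S ω) t = traj ω (t + 1)) ∧ (∀ (t : ℝ) (g : UnitAddTorus (Fin 3) → EuclideanSpace ℝ (Fin 3)), MeasureTheory.MemLp g 2 MeasureTheory.volume → Measurable fun ω => ∫ x, inner ℝ (traj ω t x) (g x)) ∧ (∀ ω, Literature.Analysis.FluidPDE.Torus.IsGlobalLerayHopf (ν j) (fun _ => ⇑(Literature.Analysis.FluidPDE.Torus.stokesMode (![0, 2, 0] : Fin 3 → ℤ) (EuclideanSpace.single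 (0 : Fin 3) (1 : ℝ)) false)) (traj ω 0) (traj ω)) ∧ (∀ ω t, 0 ≤ t → Literature.Analysis.FunctionSpaces.Torus.HasZeroMean (traj ω t)) ∧ (∀ ω, Literature.Analysis.FluidPDE.meanEnergy (traj ω) ≤ E₀) ∧ ¬ (∀ᵐ ω ∂P, ∃ v : UnitAddTorus (Fin 3), v ≠ 0 ∧ (∃ c : Fin 3 → ℤ, c 0 ≠ 0 ∧ ∑ i, c i • v i = 0) ∧ (∀ x, Literature.Analysis.FluidPDE.Torus.stokesMode (![0, 2, 0] : Fin 3 → ℤ) (EuclideanSpace.single (0 : Fin 3) (1 : ℝ)) false (x + v) = Literature.Analysis.FluidPDE.Torus.stokesMode (![0, 2, 0] : Fin 3 → ℤ) (EuclideanSpace.single (0 : Fin 3) (1 : ℝ)) false x) ∧ ∀ t : ℝ, 0 ≤ t → (fun x => traj ω t (x + v)) =ᵐ[MeasureTheory.volume] traj ω t)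

-- parent: AsymmetricBoundedLaws · glue (gen 1)
/--     item stmt-AnomalousDissipation-27449 · aside · rank 304 · closed · proved by Summit.AnomalousDissipation.AnomalousDissipation.Theorems.AsymmetricBoundedLawsGlue.asymmetricBoundedLawsGlue_holds (prover)
    parent: AsymmetricBoundedLaws · GLUE: children ⟹ parent · by planner
BoundedZMLaws → StreamwiseSymmetryUnbounded → NoPlanarTypeRelaxation → AsymmetricBoundedLaws: given
B, N yields bounded laws that are not a.s. of planar type; by T, once ν_j ≤ ν₀(E₀) no path of energy
≤ E₀ carries a streamwise-closing symmetry, so «symmetric» and «planar type» coincide pathwise and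
the laws are not a.s. symmetric; the finitely many j with ν_j > ν₀ are discarded by re-indexing ν.
KERNEL PROOF (lands verbatim, 24 lines): theorem asymmetric_of_children,
HOME/decomp-ad-lens-4/g3/SymmetryTrim.lean l.259 (lean check rc0, 0 sorry). -/
@[route_item "route-AnomalousDissipation-SymmetricOrLoud"]
def AsymmetricBoundedLawsGlue : Prop :=
  BoundedZMLaws → StreamwiseSymmetryUnbounded → NoPlanarTypeRelaxation → AsymmetricBoundedLaws

-- `AsymmetricBoundedLawsGlue` holds: proved by `Summit.AnomalousDissipation.AnomalousDissipation.Theorems.AsymmetricBoundedLawsGlue.asymmetricBoundedLawsGlue_holds` (its module imports this route file, so no `_holds` link can be stated here).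

/-- item stmt-AnomalousDissipation-28190 · aside · rank 3 · open · by planner
why it might fail: the ν-uniform mean-energy bound at a pinned force is the hard-core energy axis (GPMeanBoundedFamily); independently bounded-energy statistics could two-dimensionalise (defect → 0) as ν → 0, as layers of depth H ≲ ℓ_f/2 do — no theorem excludes it
sources: ConstantinTarfuleaVicol2013, DoeringFoias2002, doi:10.1017/jfm.2017.293, doi:10.1103/PhysRevFluids.2.054604, doi:10.1017/S0022112096001294, doi:10.1103/PhysRevE.89.023004
[crux] (DECLARED RESIDUAL of the generation-4 re-cut; INCOMPARABLE with 26490 AsymmetricBoundedLaws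
/ 27448 NoPlanarTypeRelaxation — a ν-uniform defect FLOOR is asked (stronger), discretely-refined
symmetric laws are admitted and the momentum class V is free (weaker); its zero-momentum slice
RobustSymmetryBreakingZM kernel-implies it and the energy leaf 27446 BoundedZMLaws, which stays the
necessary energy sub-leaf, UNDECIDED(T-2D kit j337935); leaf BARRIER(energy hard core G5: ν-uniform
mean-energy bound at a pinned force, GPMeanBoundedFamily census 15509) + IDEA-NEEDED (persistence of
three-dimensionality WITH a floor under ν → 0) + INSTRUMENTABLE (census T-3D-SYM-defect: E saturates
∧ ⟨defect⟩/E ≥ φ₀ uniformly in ν); NECESSARY for S_f only MODULO (trajectory→law dictionary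
LoudWindows 26822, momentum normalisation, and the un-filed aside U LoudLawsStayThreeDimensional
«loud bounded laws keep a ν-uniform defect floor» which excludes the world W_planarising-loud —
crit-1 (b)); not junk-dead: Leray–Hopf slices are L², the defect of a 3-D stationary flow is the
energy fraction off the best oblique plane, O(1) in DNS of the 3-D Kolmogorov flow) ROBUST SYMMETRY
BREAKING: there are V̄, -/
@[route_item "route-AnomalousDissipation-SymmetricOrLoud"]
def RobustSymmetryBreaking : Prop :=
  ∃ (Vb E₀ φ₀ : ℝ), 0 < φ₀ ∧ ∃ (ν : ℕ → ℝ), (∀ j, 0 < ν j) ∧ (∀ j, ν j ≤ 1) ∧ Filter.Tendsto ν Filter.atTop (nhds 0) ∧ ∀ j, ∃ (V : ℝ), |V| ≤ Vb ∧ ∃ (Ω : Type) (_ : MeasurableSpace Ω) (_ : StandardBorelSpace Ω) (P : MeasureTheory.Measure Ω) (_ : MeasureTheory.IsProbabilityMeasure P) (S : Ω → Ω) (traj : Ω → ℝ → UnitAddTorus (Fin 3) → EuclideanSpace ℝ (Fin 3)), MeasureTheory.MeasurePreserving S P P ∧ (∀ ω t, traj (S ω) t = traj ω (t + 1)) ∧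 (∀ (t : ℝ) (g : UnitAddTorus (Fin 3) → EuclideanSpace ℝ (Fin 3)), MeasureTheory.MemLp g 2 MeasureTheory.volume → Measurable fun ω => ∫ x, inner ℝ (traj ω t x) (g x)) ∧ (∀ ω, Literature.Analysis.FluidPDE.Torus.IsGlobalLerayHopf (ν j) (fun _ => ⇑(Literature.Analysis.FluidPDE.Torus.stokesMode (![0, 2, 0] : Fin 3 → ℤ) (EuclideanSpace.single (0 : Fin 3) (1 : ℝ)) false)) (traj ω 0) (traj ω)) ∧ (∀ ω t, 0 ≤ t → Literature.Analysis.FunctionSpaces.Torus.HasZeroMean (fun x => traj ω t x - V • EuclideanSpace.single (1 : Fin 3) (1 : ℝ))) ∧ (∀ ω, Literature.Analysis.FluidPDE.meanEnergy (traj ω) ≤ E₀) ∧ ¬ (∀ᵐ ω ∂P, Literature.Analysis.FluidPDE.longTimeAvgSup (fun t => ⨅ p : {p : ℤ × ℤ // p ≠ 0}, (1 / 2 : ℝ) * ∫ s in (0 : ℝ)..1, ∫ x, ‖traj ω t (x + Literature.Analysis.FluidPDE.toTorus (fun i => s * (![((p.1.1 : ℤ) : ℝ), 0, ((p.1.2 :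 ℤ) : ℝ)] : Fin 3 → ℝ) i)) - traj ω t x‖ ^ 2) < φ₀)

/-- item stmt-AnomalousDissipation-28613 · aside · rank 3 · open · by planner
why it might fail: needs a ν-uniform mean-energy bound at a pinned force (hard-core energy axis, GPMeanBoundedFamily) and bounded statistics could two-dimensionalise QUIETLY (defect → 0 and D/E → 0) as ν → 0, as thin layers H ≲ ℓ_f/2 do; implied by the zeroth law at this force
sources: ConstantinTarfuleaVicol2013, DoeringFoias2002, doi:10.1017/jfm.2017.293, doi:10.1103/PhysRevFluids.2.054604, doi:10.1017/S0022112096001294, doi:10.1103/PhysRevE.89.023004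
[crux] R_T — BOUNDED FAMILIES OUTSIDE THE NORMAL FORM: THREE-DIMENSIONAL OR LOUD (DECLARED RESIDUAL
of the generation-5 lens-4 node; KERNEL-NECESSARY for the zeroth law AT THIS FORCE:
`boundedThreeDOrLoud_of_zerothLawAt : ZerothLawAt (sin(4πx₁)e₀) → R_T` in
HOME/decomp-ad-lens-4/g5/ThreeDOrLoud.lean — re-index past ν_j < 1, E₀ := max E 1, η := ε/(2E₀);
this discharges all four necessity gaps booked on 28190 (no dictionary, no momentum normalisation,
no planarising caveat U, energy bound = S_f's own); STRICTLY WEAKER: in the world W_quiet-3D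
(bounded, quiet, robustly 3-D families along ν → 0 — exactly a ¬H_T world) R_T holds via its 3-D
disjunct and S_f is untouched; HONEST NOTE: member-wise R_T ⊇ the ratio form of S_f (loud disjunct)
— necessity is bought by admitting loud members, the content beyond S_f is the 3-D disjunct = aside
RobustlyThreeDTrajectories (kernel ⇒ R_T; 28190 ⇒ it); tags BARRIER(energy hard core G5 — ν-uniform
mean-energy bound at a pinned force, GPMeanBoundedFamily census 15509, shared with S_f itself) +
INSTRUMENTABLE(T-3D-SYM-defect: E saturation with a defect floor OR a dissipation floor) +
IDEA-NEEDED (persistence of three-dimensionality or of dissipation a -/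
@[route_item "route-AnomalousDissipation-SymmetricOrLoud"]
def BoundedThreeDOrLoud : Prop :=
  ∃ (E₀ φ₀ η : ℝ), 0 < φ₀ ∧ 0 < η ∧ ∃ (ν : ℕ → ℝ), (∀ j, 0 < ν j) ∧ (∀ j, ν j ≤ 1) ∧ Filter.Tendsto ν Filter.atTop (nhds 0) ∧ ∀ j, ∃ (u₀ : UnitAddTorus (Fin 3) → EuclideanSpace ℝ (Fin 3)) (u : ℝ → UnitAddTorus (Fin 3) → EuclideanSpace ℝ (Fin 3)), Literature.Analysis.FluidPDE.Torus.IsGlobalLerayHopf (ν j) (fun _ => ⇑(Literature.Analysis.FluidPDE.Torus.stokesMode (![0, 2, 0] : Fin 3 → ℤ) (EuclideanSpace.single (0 : Fin 3) (1 : ℝ)) false)) u₀ u ∧ Literature.Analysis.FluidPDE.meanEnergy u ≤ E₀ ∧ (φ₀ ≤ Literature.Analysis.FluidPDE.longTimeAvgSup (fun t => ⨅ p : {p : ℤ × ℤ // p ≠ 0}, (1 / 2 : ℝ) * ∫ s in (0 : ℝ)..1, ∫ x, ‖u t (x + Literature.Analysis.FluidPDE.toTorus (fun i => s * (![((p.1.1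 : ℤ) : ℝ), 0, ((p.1.2 : ℤ) : ℝ)] : Fin 3 → ℝ) i)) - u t x‖ ^ 2) ∨ η * Literature.Analysis.FluidPDE.meanEnergy u < Literature.Analysis.FluidPDE.meanDissipation (ν j) u)

/-- item stmt-AnomalousDissipation-28191 · aside · rank 9 · open · by planner
[aside] (ZERO-MOMENTUM SLICE of RobustSymmetryBreaking, V = 0 with the tree's momentum clause
HasZeroMean (traj ω t); kernel: robust_of_robustZM (⇒ RobustSymmetryBreaking) and
boundedZMLaws_of_robustZM (⇒ 27446 BoundedZMLaws) in
HOME/decomp-ad-lens-4/g4/NearSymmetricOrLoud.lean — records that the g3 energy leaf B is NECESSARY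
for this slice; banked context, not staffed) there are E₀, φ₀ > 0, 0 < ν_j ≤ 1 → 0 and for every j a
stationary Leray–Hopf trajectory law of NS_ν_j(sin(4πx₁)e₀) (format of QuietLawsAreNearlySymmetric,
zero momentum for t ≥ 0, meanEnergy ≤ E₀ on every path) which is not almost surely
φ₀-nearly-symmetric (¬ P-a.s. mean symmetry defect < φ₀). -/
@[route_item "route-AnomalousDissipation-SymmetricOrLoud"]
def RobustSymmetryBreakingZM : Prop :=
  ∃ (E₀ φ₀ : ℝ), 0 < φ₀ ∧ ∃ (ν : ℕ → ℝ), (∀ j, 0 < ν j) ∧ (∀ j, ν j ≤ 1) ∧ Filter.Tendsto ν Filter.atTop (nhds 0) ∧ ∀ j, ∃ (Ω : Type) (_ : MeasurableSpace Ω) (_ : StandardBorelSpace Ω) (P : MeasureTheory.Measure Ω) (_ : MeasureTheory.IsProbabilityMeasure P) (S : Ω → Ω) (traj : Ω → ℝ → UnitAddTorus (Fin 3) → EuclideanSpace ℝ (Fin 3)), MeasureTheory.MeasurePreserving S P P ∧ (∀ ω t, traj (S ω) t = traj ω (t + 1)) ∧ (∀ (t : ℝ) (g : UnitAddTorus (Fin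 3) → EuclideanSpace ℝ (Fin 3)), MeasureTheory.MemLp g 2 MeasureTheory.volume → Measurable fun ω => ∫ x, inner ℝ (traj ω t x) (g x)) ∧ (∀ ω, Literature.Analysis.FluidPDE.Torus.IsGlobalLerayHopf (ν j) (fun _ => ⇑(Literature.Analysis.FluidPDE.Torus.stokesMode (![0, 2, 0] : Fin 3 → ℤ) (EuclideanSpace.single (0 : Fin 3) (1 : ℝ)) false)) (traj ω 0) (traj ω)) ∧ (∀ ω t, 0 ≤ t → Literature.Analysis.FunctionSpaces.Torus.HasZeroMean (traj ω t)) ∧ (∀ ω, Literature.Analysis.FluidPDE.meanEnergy (traj ω) ≤ E₀) ∧ ¬ (∀ᵐ ω ∂P, Literature.Analysis.FluidPDE.longTimeAvgSup (fun t => ⨅ p : {p : ℤ × ℤ // p ≠ 0}, (1 / 2 : ℝ) * ∫ s in (0 : ℝ)..1, ∫ x, ‖traj ω t (x + Literature.Analysis.FluidPDE.toTorus (fun i => s * (![((p.1.1 : ℤ) : ℝ), 0, ((p.1.2 : ℤ) : ℝ)] : Fin 3 → ℝ) i)) - traj ω t x‖ ^ 2) < φ₀)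

/-- item stmt-AnomalousDissipation-28614 · aside · rank 9 · open · by planner
[aside] A_T — ROBUSTLY THREE-DIMENSIONAL BOUNDED TRAJECTORIES (the 3-D disjunct of the residual
BoundedThreeDOrLoud on its own = its content beyond the zeroth law at this force; banked context,
not staffed; kernel A_T ⇒ BoundedThreeDOrLoud and 28190 RobustSymmetryBreaking ⇒ A_T in
HOME/decomp-ad-lens-4/g5/ThreeDOrLoud.lean; INSTRUMENTABLE(T-3D-SYM-defect: mean energy saturating
in ν with a defect floor) + BARRIER(energy hard core) + IDEA-NEEDED (persistence of
three-dimensionality at bounded energy along ν → 0)). There are E₀, φ₀ > 0 and viscosities 0 < ν_j ≤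
1, ν_j → 0, with for every j a global Leray–Hopf solution of NS_ν_j(sin(4πx₁)e₀) with meanEnergy ≤
E₀ and mean symmetry defect ⟨inf_{(n,m) ≠ 0} ½∫₀¹‖u(·+s(n,0,m)) − u‖₂² ds⟩ ≥ φ₀. Why it might fail:
as for the residual, minus the loud escape — bounded statistics may two-dimensionalise as ν → 0.
Sources: doi:10.1017/S0022112096001294, doi:10.1103/PhysRevE.89.023004, doi:10.1017/jfm.2017.293. -/
@[route_item "route-AnomalousDissipation-SymmetricOrLoud"]
def RobustlyThreeDTrajectories : Prop :=
  ∃ (E₀ φ₀ : ℝ), 0 < φ₀ ∧ ∃ (ν : ℕ → ℝ), (∀ j, 0 < ν j) ∧ (∀ j, ν j ≤ 1) ∧ Filter.Tendsto ν Filter.atTop (nhds 0) ∧ ∀ j, ∃ (u₀ : UnitAddTorus (Fin 3) → EuclideanSpace ℝ (Fin 3)) (u : ℝ → UnitAddTorus (Fin 3) → EuclideanSpace ℝ (Fin 3)), Literature.Analysis.FluidPDE.Torus.IsGlobalLerayHopf (ν j) (fun _ => ⇑(Literature.Analysis.FluidPDE.Torus.stokesMode (![0, 2, 0] : Fin 3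 → ℤ) (EuclideanSpace.single (0 : Fin 3) (1 : ℝ)) false)) u₀ u ∧ Literature.Analysis.FluidPDE.meanEnergy u ≤ E₀ ∧ φ₀ ≤ Literature.Analysis.FluidPDE.longTimeAvgSup (fun t => ⨅ p : {p : ℤ × ℤ // p ≠ 0}, (1 / 2 : ℝ) * ∫ s in (0 : ℝ)..1, ∫ x, ‖u t (x + Literature.Analysis.FluidPDE.toTorus (fun i => s * (![((p.1.1 : ℤ) : ℝ), 0, ((p.1.2 : ℤ) : ℝ)] : Fin 3 → ℝ) i)) - u t x‖ ^ 2)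

/-- item stmt-AnomalousDissipation-28615 · aside · rank 9 · open · by planner
[aside/support, ATTACKABLE-NOW, M; engine isGlobalLerayHopf_steady, template
Theorems/SoloBlindDriftStates.lean] DRIFT STATES ARE LERAY–HOPF (certifies that the hypothesis class
of QuietTrajectoriesNearlySymmetric is inhabited for every θ₀ — kernel `exemption_inhabited` /
`quietTrajectories_hypotheses_met` in HOME/decomp-ad-lens-4/g5/ThreeDOrLoud.lean: for V ≠ 0, θ₀ > 0
and 0 < ν ≤ 2θ₀V⁴ the drift state is θ₀-quiet with energy ≤ V² + 1/(32π²V²) and defect 0). For every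
V and 0 < ν the drift state u = V e₁ + α sin(4πx₁)e₀ + β cos(4πx₁)e₀, α = ν/Δ, β = −V/(4πΔ), Δ = V²
+ 16π²ν², is a steady global Leray–Hopf solution of NS_ν(sin(4πx₁)e₀) with meanEnergy = V² +
1/(32π²Δ) and meanDissipation = ν/(2Δ) (coefficient algebra kernel-certified: `drift_coefficients`).
Sources: DoeringFoias2002, Frisch1995. -/
@[route_item "route-AnomalousDissipation-SymmetricOrLoud"]
def DriftStatesAreLerayHopf : Prop :=
  ∀ V ν : ℝ, 0 < ν → Literature.Analysis.FluidPDE.Torus.IsGlobalLerayHopf ν (fun _ => ⇑(Literature.Analysis.FluidPDE.Torus.stokesMode (![0, 2, 0] : Fin 3 → ℤ) (EuclideanSpace.single (0 : Fin 3) (1 : ℝ)) false)) (fun x : UnitAddTorus (Fin 3) => V • EuclideanSpace.single (1 : Fin 3) (1 : ℝ) + (ν / (V ^ 2 + 16 * Real.pi ^ 2 * ν ^ 2)) • (Literature.Analysis.FluidPDE.Torus.stokesMode (![0, 2, 0] : Fin 3 → ℤ) (EuclideanSpace.single (0 : Fin 3) (1 : ℝ)) false x) + (-V / (4 * Real.pi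 * (V ^ 2 + 16 * Real.pi ^ 2 * ν ^ 2))) • (Literature.Analysis.FluidPDE.Torus.stokesMode (![0, 2, 0] : Fin 3 → ℤ) (EuclideanSpace.single (0 : Fin 3) (1 : ℝ)) true x)) (fun _ : ℝ => (fun x : UnitAddTorus (Fin 3) => V • EuclideanSpace.single (1 : Fin 3) (1 : ℝ) + (ν / (V ^ 2 + 16 * Real.pi ^ 2 * ν ^ 2)) • (Literature.Analysis.FluidPDE.Torus.stokesMode (![0, 2, 0] : Fin 3 → ℤ) (EuclideanSpace.single (0 : Fin 3) (1 : ℝ)) false x) + (-V / (4 * Real.pi * (V ^ 2 + 16 * Real.pi ^ 2 * ν ^ 2))) • (Literature.Analysis.FluidPDE.Torus.stokesMode (![0, 2, 0] : Fin 3 → ℤ) (EuclideanSpace.single (0 : Fin 3) (1 : ℝ)) true x))) ∧ Literature.Analysis.FluidPDE.meanEnergy (fun _ : ℝ => (fun x : UnitAddTorus (Fin 3) => V • EuclideanSpace.single (1 : Fin 3) (1 : ℝ) + (ν / (V ^ 2 + 16 * Real.pi ^ 2 * ν ^ 2)) • (Literature.Analysis.FluidPDE.Torus.stokesMode (![0,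 2, 0] : Fin 3 → ℤ) (EuclideanSpace.single (0 : Fin 3) (1 : ℝ)) false x) + (-V / (4 * Real.pi * (V ^ 2 + 16 * Real.pi ^ 2 * ν ^ 2))) • (Literature.Analysis.FluidPDE.Torus.stokesMode (![0, 2, 0] : Fin 3 → ℤ) (EuclideanSpace.single (0 : Fin 3) (1 : ℝ)) true x))) = V ^ 2 + 1 / (32 * Real.pi ^ 2 * (V ^ 2 + 16 * Real.pi ^ 2 * ν ^ 2)) ∧ Literature.Analysis.FluidPDE.meanDissipation ν (fun _ : ℝ => (fun x : UnitAddTorus (Fin 3) => V • EuclideanSpace.single (1 : Fin 3) (1 : ℝ) + (ν / (V ^ 2 + 16 * Real.pi ^ 2 * ν ^ 2)) • (Literature.Analysis.FluidPDE.Torus.stokesMode (![0, 2, 0] : Fin 3 → ℤ) (EuclideanSpace.single (0 : Fin 3) (1 : ℝ)) false x) + (-V / (4 * Real.pi * (V ^ 2 + 16 * Real.pi ^ 2 * ν ^ 2))) • (Literature.Analysis.FluidPDE.Torus.stokesMode (![0, 2, 0] : Fin 3 → ℤ) (EuclideanSpace.single (0 : Fin 3) (1 : ℝ)) true x))) = ν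 / (2 * (V ^ 2 + 16 * Real.pi ^ 2 * ν ^ 2))

/-- item stmt-AnomalousDissipation-29282 · aside · rank 9 · open · by planner
[aside] (lens-4 g6 «FractionOrLoud»; BANKED CONTEXT, not a binder of closes, to be retriaged
kind=aside at once) A° RelativelyThreeDTrajectories: for some φ₀ > 0 and viscosities 0 < ν_j ≤ 1 →
0, every j admits a global Leray–Hopf solution of NS_ν_j(f), f = sin(4πx₁)e₀, of ANY energy, with 0
< mean symmetry defect and φ₀·meanEnergy ≤ defect (3-D energy fraction ≥ φ₀). This is the
relative-3-D disjunct of the residual 29278 ThreeDFractionOrLoud ON ITS OWN — the content of the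
residual beyond the zeroth law at this force; kernel (cell node file
HOME/decomp-ad-lens-4/g6/FractionOrLoud.lean): 28614 RobustlyThreeDTrajectories ⇒ A°
(relativelyThreeD_of_robustlyThreeD, φ₀ ↦ φ₀/max E₀ 1) ⇒ 29278
(threeDFractionOrLoud_of_relativelyThreeD); banked for the census instrument (T-3D-SYM-defect
relative reading: defect/E ≥ φ₀ down the ν-ladder; T-QROOT relatively-3-D steady roots of any energy
persisting under refinement). Why it might fail: as 29278's 3-D disjunct (relative
two-dimensionalisation of every family). Sources: doi:10.1017/jfm.2017.293;
doi:10.5890/jand.2019.12.007; doi:10.1088/0169-5983/48/6/061425. -/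
@[route_item "route-AnomalousDissipation-SymmetricOrLoud"]
def RelativelyThreeDTrajectories : Prop :=
  ∃ φ₀ : ℝ, 0 < φ₀ ∧ ∃ (ν : ℕ → ℝ), (∀ j, 0 < ν j) ∧ (∀ j, ν j ≤ 1) ∧ Filter.Tendsto ν Filter.atTop (nhds 0) ∧ ∀ j, ∃ (u₀ : UnitAddTorus (Fin 3) → EuclideanSpace ℝ (Fin 3)) (u : ℝ → UnitAddTorus (Fin 3) → EuclideanSpace ℝ (Fin 3)), Literature.Analysis.FluidPDE.Torus.IsGlobalLerayHopf (ν j) (fun _ => ⇑(Literature.Analysis.FluidPDE.Torus.stokesMode (![0, 2, 0] : Fin 3 → ℤ) (EuclideanSpace.single (0 : Fin 3) (1 : ℝ)) false)) u₀ u ∧ 0 < Literature.Analysis.FluidPDE.longTimeAvgSup (fun t => ⨅ p : {p : ℤ × ℤ // p ≠ 0}, (1 / 2 : ℝ) * ∫ s in (0 : ℝ)..1, ∫ x, ‖u t (x + Literature.Analysis.FluidPDE.toTorus (fun i => s * (![((p.1.1 : ℤ) : ℝ), 0, ((p.1.2 : ℤ) : ℝ)] : Fin 3 → ℝ) i)) -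 u t x‖ ^ 2) ∧ φ₀ * Literature.Analysis.FluidPDE.meanEnergy u ≤ Literature.Analysis.FluidPDE.longTimeAvgSup (fun t => ⨅ p : {p : ℤ × ℤ // p ≠ 0}, (1 / 2 : ℝ) * ∫ s in (0 : ℝ)..1, ∫ x, ‖u t (x + Literature.Analysis.FluidPDE.toTorus (fun i => s * (![((p.1.1 : ℤ) : ℝ), 0, ((p.1.2 : ℤ) : ℝ)] : Fin 3 → ℝ) i)) - u t x‖ ^ 2)

/-- item stmt-AnomalousDissipation-30320 · support · rank 9 · open · by planner
[support] BC5 RUNG of the crux PlanarStatesEject (stmt-AnomalousDissipation-30314; lens-4 g7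
PlanarEjection): P1 AT THE LAMINAR DATUM — there are c0, nu0 > 0 such that for every 0 < nu <= nu0
and eps > 0 some L2 datum within relative L2-distance eps of the laminar state sin(4 pi x1) e0 / (16
pi^2 nu) carries a global Leray-Hopf solution of NS_nu(sin(4 pi x1) e0) whose three-dimensional
energy FRACTION (instantaneous symmetry defect / energy) reaches c0 at some time t >= 0.
THEOREM-GRADE L, UNIFORM IN nu (not a finite-nu shadow): oblique Orr-Sommerfeld instability of the
profile sin(4 pi y) at the Squire-reduced wavenumber of the locked pair (1,+-1) (alpha~^2 = 8 pi^2,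
alpha~/k_f = 1/sqrt 2 < 1: inviscid Meshalkin-Sinai instability, persisting for large R) + Grenier
2000 uniform-in-nu bootstrap inside the NS-invariant class Fix(x -> x + (1/2,0,1/2)) meet Fix(x2 ->
-x2) (no 2-D unstable modes there, oblique pair locked, most unstable direction genuinely 3-D) +
Leray-Hopf energy ceiling; 2-stub skeleton HOME/decomp-ad-lens-4/g7/bc/LaminarEjection_birth.lean
(stub_obliqueOrrSommerfeld M-L, stub_grenierBootstrap L-XL, composition laminarEjection_of kernel,
c0 := theta0/K). Kernel: Plana -/
@[route_item "route-AnomalousDissipation-SymmetricOrLoud"]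
def LaminarEjection : Prop :=
  ∃ c₀ : ℝ, 0 < c₀ ∧ ∃ ν₀ : ℝ, 0 < ν₀ ∧ ∀ ν : ℝ, 0 < ν → ν ≤ ν₀ → ∀ ε : ℝ, 0 < ε → ∃ (u₀ : UnitAddTorus (Fin 3) → EuclideanSpace ℝ (Fin 3)) (u : ℝ → UnitAddTorus (Fin 3) → EuclideanSpace ℝ (Fin 3)), Literature.Analysis.FluidPDE.Torus.IsGlobalLerayHopf ν (fun _ => ⇑(Literature.Analysis.FluidPDE.Torus.stokesMode (![0, 2, 0] : Fin 3 → ℤ) (EuclideanSpace.single (0 : Fin 3) (1 : ℝ)) false)) u₀ u ∧ MeasureTheory.MemLp u₀ 2 MeasureTheory.volume ∧ ∫ x, ‖u₀ x - (16 * Real.pi ^ 2 * ν)⁻¹ • ⇑(Literature.Analysis.FluidPDE.Torus.stokesMode (![0, 2, 0] : Fin 3 → ℤ) (EuclideanSpace.single (0 : Fin 3) (1 : ℝ)) false) x‖ ^ 2 ≤ ε * ∫ x, ‖(16 * Real.pi ^ 2 * ν)⁻¹ • ⇑(Literature.Analysis.FluidPDE.Torus.stokesMode (![0, 2, 0] :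 Fin 3 → ℤ) (EuclideanSpace.single (0 : Fin 3) (1 : ℝ)) false) x‖ ^ 2 ∧ ∃ t : ℝ, 0 ≤ t ∧ 0 < (⨅ q : {q : ℤ × ℤ // q ≠ 0}, (1 / 2 : ℝ) * ∫ s in (0 : ℝ)..1, ∫ x, ‖u t (x + Literature.Analysis.FluidPDE.toTorus (fun i => s * (![((q.1.1 : ℤ) : ℝ), 0, ((q.1.2 : ℤ) : ℝ)] : Fin 3 → ℝ) i)) - u t x‖ ^ 2) ∧ c₀ * ∫ x, ‖u t x‖ ^ 2 ≤ (⨅ q : {q : ℤ × ℤ // q ≠ 0}, (1 / 2 : ℝ) * ∫ s in (0 : ℝ)..1, ∫ x, ‖u t (x + Literature.Analysis.FluidPDE.toTorus (fun i => s * (![((q.1.1 : ℤ) : ℝ), 0, ((q.1.2 : ℤ) : ℝ)] : Fin 3 → ℝ) i)) - u t x‖ ^ 2)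

/-- item stmt-AnomalousDissipation-26491 · assembly · rank 1 · open · by planner
sources: doi:10.1017/jfm.2012.524, DoeringFoias2002
[assembly] RatioUpgrade → QuietLawsAreSymmetric → AsymmetricBoundedLaws → the zeroth law (literally
theorem closes). -/
@[route_item "route-AnomalousDissipation-SymmetricOrLoud"]
def Assembly : Prop :=
  RatioUpgrade → QuietLawsAreSymmetric → AsymmetricBoundedLaws → _root_.AnomalousDissipation

/-! D-0027 §2.1 — DECIDING THEOREM (planner-authored via `route open/edit --closes-file`; by planner-decomp-ad-lens-4-g6-0 2026-08-30T06:25:25Z):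
its hypotheses are this route's items and its conclusion the sub-problem Statement (glue_lint), and it elaborates with this file. -/

@[closes "route-AnomalousDissipation-SymmetricOrLoud"] theorem closes (h₁ : RatioUpgrade) (h₂ : QuietTrajectoriesRelativelyPlanar) (h₃ : ThreeDFractionOrLoud) :
    _root_.AnomalousDissipation := by
  apply h₁
  obtain ⟨φ₀, η, hφ₀, hη, ν, hν, hν1, hν0, hfam⟩ := h₃
  obtain ⟨θ₀, hθ₀, hrig⟩ := h₂ (φ₀ / 2) (by positivity)
  have hk : ((![0, 2, 0] : Fin 3 → ℤ)) ≠ 0 := by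
    intro h
    have := congrFun h 1
    simp at this
  have hka : inner ℝ (Literature.Analysis.FunctionSpaces.Torus.latticeVec ((![0, 2, 0] : Fin 3 → ℤ)))
      (EuclideanSpace.single (0 : Fin 3) (1 : ℝ)) = 0 := by
    rw [EuclideanSpace.inner_single_right]
    simp [Literature.Analysis.FunctionSpaces.Torus.latticeVec_apply]
  -- junk-safe nonnegativity of the mean energy (inlined `Literature.Analysis.FluidPDE.meanEnergy_nonneg`)
  have hEnn : ∀ u : ℝ → UnitAddTorus (Fin 3) → EuclideanSpace ℝ (Fin 3),
      0 ≤ Literature.Analysis.FluidPDE.meanEnergy u := by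
    intro u
    show 0 ≤ Filter.limsup (Literature.Analysis.FluidPDE.timeMean fun t => ∫ x, ‖u t x‖ ^ 2) Filter.atTop
    rw [Filter.limsup_eq]
    refine Real.sInf_nonneg fun a ha => ?_
    have hpos : ∀ᶠ T : ℝ in Filter.atTop,
        0 ≤ Literature.Analysis.FluidPDE.timeMean (fun t => ∫ x, ‖u t x‖ ^ 2) T := by
      filter_upwards [Filter.eventually_ge_atTop (0 : ℝ)] with T hT
      unfold Literature.Analysis.FluidPDE.timeMean
      exact mul_nonneg (inv_nonneg.mpr hT)
        (intervalIntegral.integral_nonneg hT fun t _ => MeasureTheory.integral_nonneg fun _ => sq_nonneg _)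
    obtain ⟨T, hT0, hTa⟩ := (hpos.and ha).exists
    exact hT0.trans hTa
  have key : ∀ j, ∃ (u₀ : UnitAddTorus (Fin 3) → EuclideanSpace ℝ (Fin 3))
      (u : ℝ → UnitAddTorus (Fin 3) → EuclideanSpace ℝ (Fin 3)),
      Literature.Analysis.FluidPDE.Torus.IsGlobalLerayHopf (ν j)
          (fun _ => ⇑(Literature.Analysis.FluidPDE.Torus.stokesMode ((![0, 2, 0] : Fin 3 → ℤ))
            (EuclideanSpace.single (0 : Fin 3) (1 : ℝ)) false)) u₀ u ∧
        min θ₀ η * Literature.Analysis.FluidPDE.meanEnergy u <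
          Literature.Analysis.FluidPDE.meanDissipation (ν j) u := by
    intro j
    obtain ⟨u₀, u, hLH, halt⟩ := hfam j
    refine ⟨u₀, u, hLH, ?_⟩
    rcases halt with ⟨hpos, h3d⟩ | hloud
    · have hnq : ¬ Literature.Analysis.FluidPDE.meanDissipation (ν j) u ≤
          θ₀ * Literature.Analysis.FluidPDE.meanEnergy u := by
        intro hq
        have hsmall := hrig (ν j) (hν j) (hν1 j) u₀ u hLH hq
        have hhalf : φ₀ / 2 * Literature.Analysis.FluidPDE.meanEnergy u =
            (1 / 2 : ℝ) * (φ₀ * Literature.Analysis.FluidPDE.meanEnergy u) := by ring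
        rw [hhalf] at hsmall
        linarith
      calc min θ₀ η * Literature.Analysis.FluidPDE.meanEnergy u
          ≤ θ₀ * Literature.Analysis.FluidPDE.meanEnergy u :=
            mul_le_mul_of_nonneg_right (min_le_left _ _) (hEnn u)
        _ < Literature.Analysis.FluidPDE.meanDissipation (ν j) u := not_le.1 hnq
    · calc min θ₀ η * Literature.Analysis.FluidPDE.meanEnergy u
          ≤ η * Literature.Analysis.FluidPDE.meanEnergy u :=
            mul_le_mul_of_nonneg_right (min_le_right _ _) (hEnn u)
        _ < Literature.Analysis.FluidPDE.meanDissipation (ν j) u := hloud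
  choose u₀ u hu using key
  exact ⟨⇑(Literature.Analysis.FluidPDE.Torus.stokesMode ((![0, 2, 0] : Fin 3 → ℤ))
      (EuclideanSpace.single (0 : Fin 3) (1 : ℝ)) false),
    Literature.Analysis.FluidPDE.Torus.isSmooth_stokesMode _ _ _,
    Literature.Analysis.FluidPDE.Torus.isDivFree_stokesMode hka false,
    Literature.Analysis.FluidPDE.Torus.hasZeroMean_stokesMode hk _ _,
    min θ₀ η, lt_min hθ₀ hη, ν, u₀, u, hν, hν0, fun j => (hu j).1, fun j => (hu j).2⟩

end Summit.AnomalousDissipation.AnomalousDissipation.Theses.SymmetricOrLoud
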